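import Summits.AnomalousDissipation.AnomalousDissipation.Theorems.SawtoothPulseCascadeK1LocalisedCascadeKHSourceResponse
import Summits.AnomalousDissipation.AnomalousDissipation.Theorems.SawtoothPulseCascadeK1LocalisedCascadeKHForcingModes
import Summits.AnomalousDissipation.AnomalousDissipation.Theorems.SawtoothPulseCascadeK1LocalisedCascadeKHComponentAssembly
import Summits.AnomalousDissipation.AnomalousDissipation.Theorems.SawtoothPulseCascadeK1LocalisedCascadeKHStableRotation
import Summits.AnomalousDissipation.AnomalousDissipation.Theorems.SawtoothPulseCascadeK1LocalisedCascadeKHCreationNumericCosNegQuarter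
import Summits.AnomalousDissipation.AnomalousDissipation.Theorems.SawtoothPulseCascadeK1LocalisedCascadeKHCreationNumericSinQuarter
import Summits.AnomalousDissipation.AnomalousDissipation.Theorems.SawtoothPulseCascadeK1LocalisedCascadeKHCreationNumericSinNegQuarter
import Summits.AnomalousDissipation.AnomalousDissipation.Theorems.SawtoothPulseCascadeK1LocalisedCascadeKHSheetPairEnergyUpper

/-!
# K2 lane: p4's `sheetAmps` of a single interior mode, STABLE family — reduction BY NAME to the tree's twelve-term bounds

prover ad-k1loc-p2 g10 (K2 lane), crux workfile on the dir of stmt-AnomalousDissipation-19491. For `a ≥ 1` (stable Kelvin–Helmholtz block: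
`khLam a β < 0` by the tree's `sawC2_ge`), the created sheet amplitudes of the single interior mode `e^{2πiξy}` after strain `θ`,
`sheetAmps a β θ ⟨fun y => e^{2πiξy}, []⟩` (p4, `K2ConeSketch.lean` §0 verbatim below), are IDENTIFIED component by component with the tree's Duhamel
integrand `cos(ω(θ−s))·(cᵢSᵢ(s)) + (sin(ω(θ−s))/ω)·(X_{i0}c₀S₀(s) + X_{i1}c₁S₁(s))` (`sheetAmps_singleMode_apply`; `ω = √(a²c²) = a√(max 0 c²)`,
`c₀ = 2πia·(−2)`, `c₁ = 2πia·2`, `Sⱼ` = the single-mode sources at `y = ±¼`, `X = blockX a β`), so that `…KHComponentAssembly.norm_component_le` with the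
twelve-term bounds `…KHSourceResponse.norm_integral_{cos,sin}_src_{quarter,negQuarter}_le` (detunings from `…KHStableDetuning`/`…KHStableRotation`:
`ω ∈ [0.55a, πa/2 − 399/401]`, `sheetAmps_rate_window`) bounds `‖sheetAmps … i‖` explicitly and uniformly in `θ ≥ 0`, `β`, `ξ` (`sheetAmps_singleMode_norm_le`).
This is the by-name form of p4's single-mode stable-block creation law (P1″), amplitude level, and WITH A NUMBER: `sheetAmps_singleMode_norm_le_num_0/1`
(`‖sheetAmps a β θ (singleMode ξ) i‖ ≤ 8.5/a`, `a ≥ 1`, from the tree's `twelveTerm_*_le` numerics ≤ 0.163/a², 0.3/a³) and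
`sheetAmps_modeProfile_norm_le_num` (`≤ (Σ‖c n‖)·8.5/a`); energy: `energy_created_singleMode_le` — the created pair's energy is `≤ 2900/a ×` the mode's energy for
cascade-type lattice modes `|β+n₀| ≤ a/8+2` (`C_rig = 54`; p4's measured `3.1`/`2.2`), via `energy_singleMode`, `energy_sheetPair_le` (tree p693531).
-/

open Set MeasureTheory intervalIntegral

set_option linter.dupNamespace false

namespace Summit.AnomalousDissipation.AnomalousDissipation.Cruxes.K1LocalisedCascade.K2StableCreation

open Literature.Analysis.FluidPDE.SawtoothCascade
open Summit.AnomalousDissipation.AnomalousDissipation.Theorems.SawtoothPulseCascade.K2PhaseBudget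

noncomputable section

/-! ## Verbatim copies (p4: `K2ConeSketch.lean` §0) -/

/-- The periodised Biot–Savart LINE KERNEL (p2's corrected sign). -/
def lineKernel (a β y : ℝ) : ℂ :=
  let κ : ℝ := 2 * Real.pi * |a|
  let r : ℝ := y - (⌊y⌋ : ℝ)
  let z : ℂ := Complex.exp (2 * Real.pi * β * Complex.I)
  Complex.exp (2 * Real.pi * β * (⌊y⌋ : ℝ) * Complex.I) *
    ((-(((Real.exp (-(κ * r)) : ℂ) / (1 - (starRingEnd ℂ z) * (Real.exp (-κ) : ℂ)))
          + (Real.exp (κ * (r - 1)) : ℂ) * z / (1 - z * (Real.exp (-κ) : ℂ)))) / (2 * κ : ℂ))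

/-- Transport multiplier of an H slot of total strain `θ` on the streamwise mode `a`. -/
def transportPhase (a θ y : ℝ) : ℂ :=
  Complex.exp (-(2 * Real.pi * a * θ * triWave y : ℝ) * Complex.I)

/-- The 2 × 2 Kelvin–Helmholtz block of the kink-sheet pair. -/
def blockX (a β : ℝ) : Matrix (Fin 2) (Fin 2) ℂ :=
  ((2 * Real.pi * a : ℝ) * Complex.I : ℂ) •
    !![-(1 / 4 : ℂ) - 2 * lineKernel a β 0, -2 * lineKernel a β (1 / 2);
       2 * starRingEnd ℂ (lineKernel a β (1 / 2)), (1 / 4 : ℂ) + 2 * lineKernel a β 0]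

/-- `λ(a, β) = -a²·c²(a, β)`. -/
def khLam (a β : ℝ) : ℝ := -(a ^ 2 * sawC2 a β)

/-- `C(t)`: `cosh(√λ t)` / `cos(√(-λ) t)` / `1`. -/
def propC (a β t : ℝ) : ℝ :=
  if 0 < khLam a β then Real.cosh (Real.sqrt (khLam a β) * t)
  else if khLam a β < 0 then Real.cos (Real.sqrt (-(khLam a β)) * t) else 1

/-- `Sn(t)`: `sinh(√λ t)/√λ` / `sin(√(-λ) t)/√(-λ)` / `t`. -/
def propSn (a β t : ℝ) : ℝ :=
  if 0 < khLam a β then Real.sinh (Real.sqrt (khLam a β) * t) / Real.sqrt (khLam a β)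
  else if khLam a β < 0 then Real.sin (Real.sqrt (-(khLam a β)) * t) / Real.sqrt (-(khLam a β)) else t

/-- The explicit propagator `P(t) = C(t)·1 + Sn(t)·X`. -/
def propagator (a β t : ℝ) : Matrix (Fin 2) (Fin 2) ℂ :=
  ((propC a β t : ℝ) : ℂ) • (1 : Matrix (Fin 2) (Fin 2) ℂ) + ((propSn a β t : ℝ) : ℂ) • blockX a β

/-- S-4 state of ONE line family. -/
structure LamState where
  interior : ℝ → ℂ
  sheets : List (ℝ × ℂ)

/-- Forcing of the block at slot-time `s`. -/
def forcing (a β : ℝ) (st : LamState) (s : ℝ) : Fin 2 → ℂ :=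
  let src : ℝ → ℂ := fun y0 =>
    (∫ y in (-(1 / 2 : ℝ))..(1 / 2), lineKernel a β (y0 - y) * st.interior y * transportPhase a s y)
      + (st.sheets.map (fun p => lineKernel a β (y0 - p.1) * p.2 * transportPhase a s p.1)).sum
  ![((2 * Real.pi * a : ℝ) * Complex.I : ℂ) * (-2) * src (1 / 4),
    ((2 * Real.pi * a : ℝ) * Complex.I : ℂ) * 2 * src (-(1 / 4))]

/-- Fresh sheet amplitudes after strain `θ` (Duhamel): `q(θ) = ∫₀^θ P(θ - s) f(s) ds`. -/
def sheetAmps (a β θ : ℝ) (st : LamState) : Fin 2 → ℂ :=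
  ∫ s in (0 : ℝ)..θ, (propagator a β (θ - s)).mulVec (forcing a β st s)

/-! ## The single interior mode and the stable branch -/

/-- The single interior mode `e^{2πiξy}` (no sheets). -/
def singleMode (ξ : ℝ) : LamState := ⟨fun y => Complex.exp (((2 * Real.pi * ξ * y : ℝ) : ℂ) * Complex.I), []⟩

/-- The tree's closed form of the kernel on one period. -/
def kernelK (a β : ℝ) : ℝ → ℂ := fun r : ℝ => (-((Real.exp (-(2 * Real.pi * a * r)) : ℂ) /
            (1 - starRingEnd ℂ (Complex.exp (2 * Real.pi * β * Complex.I)) * (Real.exp (-(2 * Real.pi * a)) : ℂ))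
          + (Real.exp (2 * Real.pi * a * (r - 1)) : ℂ) * Complex.exp (2 * Real.pi * β * Complex.I) /
            (1 - Complex.exp (2 * Real.pi * β * Complex.I) * (Real.exp (-(2 * Real.pi * a)) : ℂ))) /
        (2 * (2 * Real.pi * a) : ℂ))

/-- For `a > 0`, `lineKernel a β u = e^{2πiβ⌊u⌋} kernelK a β (u − ⌊u⌋)`. -/
theorem lineKernel_eq {a : ℝ} (ha : 0 < a) (β : ℝ) (u : ℝ) :
    lineKernel a β u = Complex.exp (2 * Real.pi * β * (⌊u⌋ : ℝ) * Complex.I) * kernelK a β (u - ⌊u⌋) := by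
  simp only [lineKernel, kernelK, abs_of_pos ha]
  push_cast
  ring_nf

/-- The single-mode source at the kink line `y₀` as a function of the strain time. -/
def src (a β ξ y₀ : ℝ) : ℝ → ℂ := fun s =>
  ∫ y in (-(1 / 2 : ℝ))..(1 / 2 : ℝ), lineKernel a β (y₀ - y) * Complex.exp (((2 * Real.pi * ξ * y : ℝ) : ℂ) * Complex.I) *
    Complex.exp (-((2 * Real.pi * a * s * triWave y : ℝ) : ℂ) * Complex.I)

/-- The forcing of the single mode: `f(s) = (2πia·(−2)·src(¼,s), 2πia·2·src(−¼,s))`. -/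
theorem forcing_singleMode (a β ξ s : ℝ) :
    forcing a β (singleMode ξ) s = ![((2 * Real.pi * a : ℝ) * Complex.I : ℂ) * (-2) * src a β ξ (1 / 4) s,
      ((2 * Real.pi * a : ℝ) * Complex.I : ℂ) * 2 * src a β ξ (-(1 / 4)) s] := by
  simp only [forcing, singleMode, transportPhase, src, List.map_nil, List.sum_nil, add_zero]

/-- For `a ≥ 1` the family is STABLE: `khLam a β < 0` (tree `sawC2_ge`: `c² ≥ 0.3025`). -/
theorem khLam_neg {a : ℝ} (ha : 1 ≤ a) (β : ℝ) : khLam a β < 0 := by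
  unfold khLam
  have h := sawC2_ge ha β
  have : 0 < a ^ 2 * sawC2 a β := by positivity
  linarith

/-- The rotation rate `ω = √(−λ) = a·√(max 0 c²)` for `a ≥ 1`. -/
theorem sqrt_neg_khLam_eq {a : ℝ} (ha : 1 ≤ a) (β : ℝ) : Real.sqrt (-(khLam a β)) = a * Real.sqrt (max 0 (sawC2 a β)) := by
  unfold khLam
  have hc : 0 ≤ sawC2 a β := by linarith [sawC2_ge ha β]
  rw [neg_neg, max_eq_right hc, Real.sqrt_mul' _ hc, Real.sqrt_sq (by linarith)]

/-- The rate window and the three non-resonances for `a ≥ 1`: `ω ∈ [0.55a, πa/2 − 399/401]`, so `ω ≠ 0`, `πa/2 − ω ≠ 0`, `πa/2 + ω ≠ 0`. -/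
theorem sheetAmps_rate_window {a : ℝ} (ha : 1 ≤ a) (β : ℝ) :
    0.55 * a ≤ Real.sqrt (-(khLam a β)) ∧ Real.sqrt (-(khLam a β)) ≤ Real.pi * a / 2 - 399 / 401 ∧
      Real.sqrt (-(khLam a β)) ≠ 0 ∧ Real.pi * a / 2 - Real.sqrt (-(khLam a β)) ≠ 0 ∧ Real.pi * a / 2 + Real.sqrt (-(khLam a β)) ≠ 0 := by
  rw [sqrt_neg_khLam_eq ha]
  have h1 := omega_ge ha β
  have h2 := stable_detuning ha β
  have h3 : 0 ≤ a * Real.sqrt (max 0 (sawC2 a β)) := by positivity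
  refine ⟨h1, by linarith, by intro h; linarith, by intro h; linarith, by intro h; linarith⟩

/-- The stable propagator entries: `propC = cos(ωt)`, `propSn = sin(ωt)/ω`. -/
theorem propC_eq {a : ℝ} (ha : 1 ≤ a) (β t : ℝ) : propC a β t = Real.cos (Real.sqrt (-(khLam a β)) * t) := by
  have h := khLam_neg ha β
  simp only [propC, if_neg (not_lt.2 h.le), if_pos h]

/-- `propSn = sin(ωt)/ω` on the stable branch. -/
theorem propSn_eq {a : ℝ} (ha : 1 ≤ a) (β t : ℝ) :
    propSn a β t = Real.sin (Real.sqrt (-(khLam a β)) * t) / Real.sqrt (-(khLam a β)) := by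
  have h := khLam_neg ha β
  simp only [propSn, if_neg (not_lt.2 h.le), if_pos h]

/-! ## The sources are the tree's pieces: continuity in the strain time -/

/-- `src` at `y₀ = ¼` is continuous in `s` (closed form = three continuous pieces). -/
theorem continuous_src {a : ℝ} (ha : 0 < a) (β ξ : ℝ) {y₀ : ℝ} (hy₀ : y₀ = 1 / 4 ∨ y₀ = -(1 / 4)) : Continuous (src a β ξ y₀) := by
  have hμ1 : (2 * Real.pi * a : ℝ) ≠ 0 := by positivity
  have hμ2 : (-(2 * Real.pi * a) : ℝ) ≠ 0 := by
    have h2 : (0:ℝ) < 2 * Real.pi * a := by positivity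
    linarith
  have hc : ∀ (φ₀ : ℝ) (c₁ c₂ : ℂ) (ν y₁ y₂ : ℝ), Continuous fun s : ℝ =>
      (Complex.exp (((φ₀ * s : ℝ)) * Complex.I) *
        (c₁ * ((Complex.exp ((((((2 * Real.pi * a) : ℝ)) : ℂ) + ((((2 * Real.pi * ξ) + ν * s : ℝ)) : ℂ) * Complex.I) * y₂) -
            Complex.exp ((((((2 * Real.pi * a) : ℝ)) : ℂ) + ((((2 * Real.pi * ξ) + ν * s : ℝ)) : ℂ) * Complex.I) * y₁)) /
            (((((2 * Real.pi * a) : ℝ)) : ℂ) + ((((2 * Real.pi * ξ) + ν * s : ℝ)) : ℂ) * Complex.I)) +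
         c₂ * ((Complex.exp ((((((-(2 * Real.pi * a)) : ℝ)) : ℂ) + ((((2 * Real.pi * ξ) + ν * s : ℝ)) : ℂ) * Complex.I) * y₂) -
            Complex.exp ((((((-(2 * Real.pi * a)) : ℝ)) : ℂ) + ((((2 * Real.pi * ξ) + ν * s : ℝ)) : ℂ) * Complex.I) * y₁)) /
            (((((-(2 * Real.pi * a)) : ℝ)) : ℂ) + ((((2 * Real.pi * ξ) + ν * s : ℝ)) : ℂ) * Complex.I)))) := by
    intro φ₀ c₁ c₂ ν y₁ y₂
    have d1 : ∀ s : ℝ, ((((2 * Real.pi * a) : ℝ)) : ℂ) + ((((2 * Real.pi * ξ) + ν * s : ℝ)) : ℂ) * Complex.I ≠ 0 :=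
      fun s => lorentz_denom_ne_zero hμ1 _
    have d2 : ∀ s : ℝ, ((((-(2 * Real.pi * a)) : ℝ)) : ℂ) + ((((2 * Real.pi * ξ) + ν * s : ℝ)) : ℂ) * Complex.I ≠ 0 :=
      fun s => lorentz_denom_ne_zero hμ2 _
    refine Continuous.mul (by fun_prop) (Continuous.add ?_ ?_)
    · exact continuous_const.mul (Continuous.div (by fun_prop) (by fun_prop) d1)
    · exact continuous_const.mul (Continuous.div (by fun_prop) (by fun_prop) d2)
  rcases hy₀ with h | h <;> subst h
  · have e : src a β ξ (1 / 4) = fun s => src a β ξ (1 / 4) s := rfl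
    rw [e]; simp only [src]
    simp_rw [src_quarter_pieces ha β ξ (K := kernelK a β) rfl (lineKernel_eq ha β)]
    exact ((hc _ _ _ _ _ _).add (hc _ _ _ _ _ _)).add (hc _ _ _ _ _ _)
  · have e : src a β ξ (-(1 / 4)) = fun s => src a β ξ (-(1 / 4)) s := rfl
    rw [e]; simp only [src]
    simp_rw [src_negQuarter_pieces ha β ξ (K := kernelK a β) rfl (lineKernel_eq ha β)]
    exact ((hc _ _ _ _ _ _).add (hc _ _ _ _ _ _)).add (hc _ _ _ _ _ _)


/-! ## The reduction: p4's `sheetAmps` of the single mode IS the tree's Duhamel integral -/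

/-- The Duhamel integrand is continuous in the strain time (stable branch, sources continuous). -/
theorem continuous_duhamelIntegrand {a : ℝ} (ha : 1 ≤ a) (β ξ θ : ℝ) :
    Continuous fun s : ℝ => (propagator a β (θ - s)).mulVec (forcing a β (singleMode ξ) s) := by
  have ha0 : 0 < a := by linarith
  have hs0 := continuous_src ha0 β ξ (y₀ := 1 / 4) (Or.inl rfl)
  have hs1 := continuous_src ha0 β ξ (y₀ := -(1 / 4)) (Or.inr rfl)
  apply continuous_pi
  intro j
  simp only [forcing_singleMode, propagator, propC_eq ha, propSn_eq ha, Matrix.add_mulVec, Matrix.smul_mulVec, Matrix.one_mulVec]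
  simp only [Pi.add_apply, Pi.smul_apply, smul_eq_mul, Matrix.mulVec, dotProduct, Fin.sum_univ_two]
  fin_cases j
  · simp only [Fin.zero_eta, Fin.isValue, Matrix.cons_val_zero, Matrix.cons_val_one]
    fun_prop
  · simp only [Fin.mk_one, Fin.isValue, Matrix.cons_val_zero, Matrix.cons_val_one]
    fun_prop

/-- **Reduction, component `0`:** `sheetAmps a β θ (singleMode ξ) 0` is the tree's Duhamel integral with kernels `cos(ω(θ−s))`, `sin(ω(θ−s))/ω`
(`ω = √(−λ)`), couplings `c₀ = 2πia·(−2)`, `c₁ = 2πia·2`, block entries `blockX a β 0 j`, sources `src a β ξ (±¼)` (`a ≥ 1`). -/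
theorem sheetAmps_singleMode_apply_0 {a : ℝ} (ha : 1 ≤ a) (β ξ θ : ℝ) :
    sheetAmps a β θ (singleMode ξ) 0 = ∫ s in (0 : ℝ)..θ,
      ((Real.cos (Real.sqrt (-(khLam a β)) * (θ - s)) : ℂ) * ((((2 * Real.pi * a : ℝ) * Complex.I : ℂ) * (-2)) * src a β ξ (1 / 4) s) +
        ((Real.sin (Real.sqrt (-(khLam a β)) * (θ - s)) / Real.sqrt (-(khLam a β)) : ℝ) : ℂ) * (blockX a β 0 0 * ((((2 * Real.pi * a : ℝ) * Complex.I : ℂ) * (-2)) * src a β ξ (1 / 4) s) + blockX a β 0 1 * ((((2 * Real.pi * a : ℝ) * Complex.I : ℂ) * 2) * src a β ξ (-(1 / 4)) s))) := by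
  have hint := (continuous_duhamelIntegrand ha β ξ θ).intervalIntegrable (μ := volume) 0 θ
  have hcomp := ((ContinuousLinearMap.proj (R := ℂ) (φ := fun _ : Fin 2 => ℂ) (0 : Fin 2)).intervalIntegral_comp_comm hint).symm
  simp only [ContinuousLinearMap.proj_apply] at hcomp
  unfold sheetAmps
  rw [hcomp]
  refine intervalIntegral.integral_congr fun s _ => ?_
  simp only [forcing_singleMode, propagator, propC_eq ha, propSn_eq ha, Matrix.add_mulVec, Matrix.smul_mulVec, Matrix.one_mulVec]
  simp only [Pi.add_apply, Pi.smul_apply, smul_eq_mul, Matrix.mulVec, dotProduct, Fin.sum_univ_two, Fin.isValue, Matrix.cons_val_zero,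
    Matrix.cons_val_one]

/-- **Reduction, component `1`:** `sheetAmps a β θ (singleMode ξ) 1` is the tree's Duhamel integral with kernels `cos(ω(θ−s))`, `sin(ω(θ−s))/ω`
(`ω = √(−λ)`), couplings `c₀ = 2πia·(−2)`, `c₁ = 2πia·2`, block entries `blockX a β 1 j`, sources `src a β ξ (±¼)` (`a ≥ 1`). -/
theorem sheetAmps_singleMode_apply_1 {a : ℝ} (ha : 1 ≤ a) (β ξ θ : ℝ) :
    sheetAmps a β θ (singleMode ξ) 1 = ∫ s in (0 : ℝ)..θ,
      ((Real.cos (Real.sqrt (-(khLam a β)) * (θ - s)) : ℂ) * ((((2 * Real.pi * a : ℝ) * Complex.I : ℂ) * 2) * src a β ξ (-(1 / 4)) s) +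
        ((Real.sin (Real.sqrt (-(khLam a β)) * (θ - s)) / Real.sqrt (-(khLam a β)) : ℝ) : ℂ) * (blockX a β 1 0 * ((((2 * Real.pi * a : ℝ) * Complex.I : ℂ) * (-2)) * src a β ξ (1 / 4) s) + blockX a β 1 1 * ((((2 * Real.pi * a : ℝ) * Complex.I : ℂ) * 2) * src a β ξ (-(1 / 4)) s))) := by
  have hint := (continuous_duhamelIntegrand ha β ξ θ).intervalIntegrable (μ := volume) 0 θ
  have hcomp := ((ContinuousLinearMap.proj (R := ℂ) (φ := fun _ : Fin 2 => ℂ) (1 : Fin 2)).intervalIntegral_comp_comm hint).symm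
  simp only [ContinuousLinearMap.proj_apply] at hcomp
  unfold sheetAmps
  rw [hcomp]
  refine intervalIntegral.integral_congr fun s _ => ?_
  simp only [forcing_singleMode, propagator, propC_eq ha, propSn_eq ha, Matrix.add_mulVec, Matrix.smul_mulVec, Matrix.one_mulVec]
  simp only [Pi.add_apply, Pi.smul_apply, smul_eq_mul, Matrix.mulVec, dotProduct, Fin.sum_univ_two, Fin.isValue, Matrix.cons_val_zero,
    Matrix.cons_val_one]

/-- **Single-mode stable-block creation, component `0`, BY NAME** (`a ≥ 1`, `θ ≥ 0`, any `β`, `ξ`): `‖sheetAmps a β θ (singleMode ξ) 0‖` is at most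
`‖c_0‖·Bc + ‖X_00‖‖c₀‖·Bs₀ + ‖X_01‖‖c₁‖·Bs₁` with the tree's explicit twelve-term bounds (`ω = √(−λ) ∈ [0.55a, πa/2 − 399/401]`). -/
theorem sheetAmps_singleMode_norm_le_0 {a : ℝ} (ha : 1 ≤ a) (β ξ : ℝ) {θ : ℝ} (hθ : 0 ≤ θ) :
    ‖sheetAmps a β θ (singleMode ξ) 0‖ ≤
      ‖(((2 * Real.pi * a : ℝ) * Complex.I : ℂ) * (-2))‖ *
      (((‖((1 : ℂ) * (-1 / ((1 - starRingEnd ℂ (Complex.exp (2 * Real.pi * β * Complex.I)) * (Real.exp (-(2 * Real.pi * a)) : ℂ)) * (2 * (2 * Real.pi * a)))) * Complex.exp (-((2 * Real.pi * a : ℝ) : ℂ) * (1 / 4 : ℝ)))‖ * Real.exp ((2 * Real.pi * a) * (-(1 / 4 : ℝ))) * (2 + Real.pi) / |(2 * Real.pi * a)| * (1 / |(Real.pi * a) + (2 * Real.pi * a) * (-(1 / 4 : ℝ)) - Real.sqrt (-(khLam a β))| + 1 / |(Real.pi * a) + (2 * Real.pi * a) * (-(1 / 4 : ℝ)) + Real.sqrt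 (-(khLam a β))|) * (1 / 2) +
        ‖((1 : ℂ) * (-1 / ((1 - starRingEnd ℂ (Complex.exp (2 * Real.pi * β * Complex.I)) * (Real.exp (-(2 * Real.pi * a)) : ℂ)) * (2 * (2 * Real.pi * a)))) * Complex.exp (-((2 * Real.pi * a : ℝ) : ℂ) * (1 / 4 : ℝ)))‖ * Real.exp ((2 * Real.pi * a) * (-(1 / 2 : ℝ))) * (2 + Real.pi) / |(2 * Real.pi * a)| * (1 / |(Real.pi * a) + (2 * Real.pi * a) * (-(1 / 2 : ℝ)) - Real.sqrt (-(khLam a β))| + 1 / |(Real.pi * a) + (2 * Real.pi * a) * (-(1 / 2 : ℝ)) + Real.sqrt (-(khLam a β))|) * (1 / 2)) +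
      (‖((1 : ℂ) * (-(Complex.exp (2 * Real.pi * β * Complex.I) * (Real.exp (-(2 * Real.pi * a)) : ℂ)) / ((1 - Complex.exp (2 * Real.pi * β * Complex.I) * (Real.exp (-(2 * Real.pi * a)) : ℂ)) * (2 * (2 * Real.pi * a)))) * Complex.exp (((2 * Real.pi * a : ℝ) : ℂ) * (1 / 4 : ℝ)))‖ * Real.exp ((-(2 * Real.pi * a)) * (-(1 / 4 : ℝ))) * (2 + Real.pi) / |(-(2 * Real.pi * a))| * (1 / |(Real.pi * a) + (2 * Real.pi * a) * (-(1 / 4 : ℝ)) - Real.sqrt (-(khLam a β))| + 1 / |(Real.pi * a) + (2 * Real.pi * a) * (-(1 / 4 : ℝ)) + Real.sqrt (-(khLam a β))|) * (1 / 2) +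
        ‖((1 : ℂ) * (-(Complex.exp (2 * Real.pi * β * Complex.I) * (Real.exp (-(2 * Real.pi * a)) : ℂ)) / ((1 - Complex.exp (2 * Real.pi * β * Complex.I) * (Real.exp (-(2 * Real.pi * a)) : ℂ)) * (2 * (2 * Real.pi * a)))) * Complex.exp (((2 * Real.pi * a : ℝ) : ℂ) * (1 / 4 : ℝ)))‖ * Real.exp ((-(2 * Real.pi * a)) * (-(1 / 2 : ℝ))) * (2 + Real.pi) / |(-(2 * Real.pi * a))| * (1 / |(Real.pi * a) + (2 * Real.pi * a) * (-(1 / 2 : ℝ)) - Real.sqrt (-(khLam a β))| + 1 / |(Real.pi * a) + (2 * Real.pi * a) * (-(1 / 2 : ℝ)) + Real.sqrt (-(khLam a β))|) * (1 / 2))) +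
      ((‖((1 : ℂ) * (-1 / ((1 - starRingEnd ℂ (Complex.exp (2 * Real.pi * β * Complex.I)) * (Real.exp (-(2 * Real.pi * a)) : ℂ)) * (2 * (2 * Real.pi * a)))) * Complex.exp (-((2 * Real.pi * a : ℝ) : ℂ) * (1 / 4 : ℝ)))‖ * Real.exp ((2 * Real.pi * a) * (1 / 4 : ℝ)) * (2 + Real.pi) / |(2 * Real.pi * a)| * (1 / |(0 : ℝ) + (-(2 * Real.pi * a)) * (1 / 4 : ℝ) - Real.sqrt (-(khLam a β))| + 1 / |(0 : ℝ) + (-(2 * Real.pi * a)) * (1 / 4 : ℝ) + Real.sqrt (-(khLam a β))|) * (1 / 2) +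
        ‖((1 : ℂ) * (-1 / ((1 - starRingEnd ℂ (Complex.exp (2 * Real.pi * β * Complex.I)) * (Real.exp (-(2 * Real.pi * a)) : ℂ)) * (2 * (2 * Real.pi * a)))) * Complex.exp (-((2 * Real.pi * a : ℝ) : ℂ) * (1 / 4 : ℝ)))‖ * Real.exp ((2 * Real.pi * a) * (-(1 / 4 : ℝ))) * (2 + Real.pi) / |(2 * Real.pi * a)| * (1 / |(0 : ℝ) + (-(2 * Real.pi * a)) * (-(1 / 4 : ℝ)) - Real.sqrt (-(khLam a β))| + 1 / |(0 : ℝ) + (-(2 * Real.pi * a)) * (-(1 / 4 : ℝ)) + Real.sqrt (-(khLam a β))|) * (1 / 2)) +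
      (‖((1 : ℂ) * (-(Complex.exp (2 * Real.pi * β * Complex.I) * (Real.exp (-(2 * Real.pi * a)) : ℂ)) / ((1 - Complex.exp (2 * Real.pi * β * Complex.I) * (Real.exp (-(2 * Real.pi * a)) : ℂ)) * (2 * (2 * Real.pi * a)))) * Complex.exp (((2 * Real.pi * a : ℝ) : ℂ) * (1 / 4 : ℝ)))‖ * Real.exp ((-(2 * Real.pi * a)) * (1 / 4 : ℝ)) * (2 + Real.pi) / |(-(2 * Real.pi * a))| * (1 / |(0 : ℝ) + (-(2 * Real.pi * a)) * (1 / 4 : ℝ) - Real.sqrt (-(khLam a β))| + 1 / |(0 : ℝ) + (-(2 * Real.pi * a)) * (1 / 4 : ℝ) + Real.sqrt (-(khLam a β))|) * (1 / 2) +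
        ‖((1 : ℂ) * (-(Complex.exp (2 * Real.pi * β * Complex.I) * (Real.exp (-(2 * Real.pi * a)) : ℂ)) / ((1 - Complex.exp (2 * Real.pi * β * Complex.I) * (Real.exp (-(2 * Real.pi * a)) : ℂ)) * (2 * (2 * Real.pi * a)))) * Complex.exp (((2 * Real.pi * a : ℝ) : ℂ) * (1 / 4 : ℝ)))‖ * Real.exp ((-(2 * Real.pi * a)) * (-(1 / 4 : ℝ))) * (2 + Real.pi) / |(-(2 * Real.pi * a))| * (1 / |(0 : ℝ) + (-(2 * Real.pi * a)) * (-(1 / 4 : ℝ)) - Real.sqrt (-(khLam a β))| + 1 / |(0 : ℝ) + (-(2 * Real.pi * a)) * (-(1 / 4 : ℝ)) + Real.sqrt (-(khLam a β))|) * (1 / 2))) +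
      ((‖((starRingEnd ℂ (Complex.exp (2 * Real.pi * β * Complex.I))) * (-1 / ((1 - starRingEnd ℂ (Complex.exp (2 * Real.pi * β * Complex.I)) * (Real.exp (-(2 * Real.pi * a)) : ℂ)) * (2 * (2 * Real.pi * a)))) * Complex.exp (-((2 * Real.pi * a : ℝ) : ℂ) * (5 / 4 : ℝ)))‖ * Real.exp ((2 * Real.pi * a) * (1 / 2 : ℝ)) * (2 + Real.pi) / |(2 * Real.pi * a)| * (1 / |(-(Real.pi * a)) + (2 * Real.pi * a) * (1 / 2 : ℝ) - Real.sqrt (-(khLam a β))| + 1 / |(-(Real.pi * a)) + (2 * Real.pi * a) * (1 / 2 : ℝ) + Real.sqrt (-(khLam a β))|) * (1 / 2) +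
        ‖((starRingEnd ℂ (Complex.exp (2 * Real.pi * β * Complex.I))) * (-1 / ((1 - starRingEnd ℂ (Complex.exp (2 * Real.pi * β * Complex.I)) * (Real.exp (-(2 * Real.pi * a)) : ℂ)) * (2 * (2 * Real.pi * a)))) * Complex.exp (-((2 * Real.pi * a : ℝ) : ℂ) * (5 / 4 : ℝ)))‖ * Real.exp ((2 * Real.pi * a) * (1 / 4 : ℝ)) * (2 + Real.pi) / |(2 * Real.pi * a)| * (1 / |(-(Real.pi * a)) + (2 * Real.pi * a) * (1 / 4 : ℝ) - Real.sqrt (-(khLam a β))| + 1 / |(-(Real.pi * a)) + (2 * Real.pi * a) * (1 / 4 : ℝ) + Real.sqrt (-(khLam a β))|) * (1 / 2)) +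
      (‖((starRingEnd ℂ (Complex.exp (2 * Real.pi * β * Complex.I))) * (-(Complex.exp (2 * Real.pi * β * Complex.I) * (Real.exp (-(2 * Real.pi * a)) : ℂ)) / ((1 - Complex.exp (2 * Real.pi * β * Complex.I) * (Real.exp (-(2 * Real.pi * a)) : ℂ)) * (2 * (2 * Real.pi * a)))) * Complex.exp (((2 * Real.pi * a : ℝ) : ℂ) * (5 / 4 : ℝ)))‖ * Real.exp ((-(2 * Real.pi * a)) * (1 / 2 : ℝ)) * (2 + Real.pi) / |(-(2 * Real.pi * a))| * (1 / |(-(Real.pi * a)) + (2 * Real.pi * a) * (1 / 2 : ℝ) - Real.sqrt (-(khLam a β))| + 1 / |(-(Real.pi * a)) + (2 * Real.pi * a) * (1 / 2 : ℝ) + Real.sqrt (-(khLam a β))|) * (1 / 2) +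
        ‖((starRingEnd ℂ (Complex.exp (2 * Real.pi * β * Complex.I))) * (-(Complex.exp (2 * Real.pi * β * Complex.I) * (Real.exp (-(2 * Real.pi * a)) : ℂ)) / ((1 - Complex.exp (2 * Real.pi * β * Complex.I) * (Real.exp (-(2 * Real.pi * a)) : ℂ)) * (2 * (2 * Real.pi * a)))) * Complex.exp (((2 * Real.pi * a : ℝ) : ℂ) * (5 / 4 : ℝ)))‖ * Real.exp ((-(2 * Real.pi * a)) * (1 / 4 : ℝ)) * (2 + Real.pi) / |(-(2 * Real.pi * a))| * (1 / |(-(Real.pi * a)) + (2 * Real.pi * a) * (1 / 4 : ℝ) - Real.sqrt (-(khLam a β))| + 1 / |(-(Real.pi * a)) + (2 * Real.pi * a) * (1 / 4 : ℝ) + Real.sqrt (-(khLam a β))|) * (1 / 2)))) +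
      ‖blockX a β 0 0‖ * ‖(((2 * Real.pi * a : ℝ) * Complex.I : ℂ) * (-2))‖ *
      (((‖((1 : ℂ) * (-1 / ((1 - starRingEnd ℂ (Complex.exp (2 * Real.pi * β * Complex.I)) * (Real.exp (-(2 * Real.pi * a)) : ℂ)) * (2 * (2 * Real.pi * a)))) * Complex.exp (-((2 * Real.pi * a : ℝ) : ℂ) * (1 / 4 : ℝ)))‖ * Real.exp ((2 * Real.pi * a) * (-(1 / 4 : ℝ))) * (2 + Real.pi) / |(2 * Real.pi * a)| * (1 / |(Real.pi * a) + (2 * Real.pi * a) * (-(1 / 4 : ℝ)) - Real.sqrt (-(khLam a β))| + 1 / |(Real.pi * a) + (2 * Real.pi * a) * (-(1 / 4 : ℝ)) + Real.sqrt (-(khLam a β))|) * (1 / (2 * |Real.sqrt (-(khLam a β))|)) +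
        ‖((1 : ℂ) * (-1 / ((1 - starRingEnd ℂ (Complex.exp (2 * Real.pi * β * Complex.I)) * (Real.exp (-(2 * Real.pi * a)) : ℂ)) * (2 * (2 * Real.pi * a)))) * Complex.exp (-((2 * Real.pi * a : ℝ) : ℂ) * (1 / 4 : ℝ)))‖ * Real.exp ((2 * Real.pi * a) * (-(1 / 2 : ℝ))) * (2 + Real.pi) / |(2 * Real.pi * a)| * (1 / |(Real.pi * a) + (2 * Real.pi * a) * (-(1 / 2 : ℝ)) - Real.sqrt (-(khLam a β))| + 1 / |(Real.pi * a) + (2 * Real.pi * a) * (-(1 / 2 : ℝ)) + Real.sqrt (-(khLam a β))|) * (1 / (2 * |Real.sqrt (-(khLam a β))|))) +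
      (‖((1 : ℂ) * (-(Complex.exp (2 * Real.pi * β * Complex.I) * (Real.exp (-(2 * Real.pi * a)) : ℂ)) / ((1 - Complex.exp (2 * Real.pi * β * Complex.I) * (Real.exp (-(2 * Real.pi * a)) : ℂ)) * (2 * (2 * Real.pi * a)))) * Complex.exp (((2 * Real.pi * a : ℝ) : ℂ) * (1 / 4 : ℝ)))‖ * Real.exp ((-(2 * Real.pi * a)) * (-(1 / 4 : ℝ))) * (2 + Real.pi) / |(-(2 * Real.pi * a))| * (1 / |(Real.pi * a) + (2 * Real.pi * a) * (-(1 / 4 : ℝ)) - Real.sqrt (-(khLam a β))| + 1 / |(Real.pi * a) + (2 * Real.pi * a) * (-(1 / 4 : ℝ)) + Real.sqrt (-(khLam a β))|) * (1 / (2 * |Real.sqrt (-(khLam a β))|)) +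
        ‖((1 : ℂ) * (-(Complex.exp (2 * Real.pi * β * Complex.I) * (Real.exp (-(2 * Real.pi * a)) : ℂ)) / ((1 - Complex.exp (2 * Real.pi * β * Complex.I) * (Real.exp (-(2 * Real.pi * a)) : ℂ)) * (2 * (2 * Real.pi * a)))) * Complex.exp (((2 * Real.pi * a : ℝ) : ℂ) * (1 / 4 : ℝ)))‖ * Real.exp ((-(2 * Real.pi * a)) * (-(1 / 2 : ℝ))) * (2 + Real.pi) / |(-(2 * Real.pi * a))| * (1 / |(Real.pi * a) + (2 * Real.pi * a) * (-(1 / 2 : ℝ)) - Real.sqrt (-(khLam a β))| + 1 / |(Real.pi * a) + (2 * Real.pi * a) * (-(1 / 2 : ℝ)) + Real.sqrt (-(khLam a β))|) * (1 / (2 * |Real.sqrt (-(khLam a β))|)))) +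
      ((‖((1 : ℂ) * (-1 / ((1 - starRingEnd ℂ (Complex.exp (2 * Real.pi * β * Complex.I)) * (Real.exp (-(2 * Real.pi * a)) : ℂ)) * (2 * (2 * Real.pi * a)))) * Complex.exp (-((2 * Real.pi * a : ℝ) : ℂ) * (1 / 4 : ℝ)))‖ * Real.exp ((2 * Real.pi * a) * (1 / 4 : ℝ)) * (2 + Real.pi) / |(2 * Real.pi * a)| * (1 / |(0 : ℝ) + (-(2 * Real.pi * a)) * (1 / 4 : ℝ) - Real.sqrt (-(khLam a β))| + 1 / |(0 : ℝ) + (-(2 * Real.pi * a)) * (1 / 4 : ℝ) + Real.sqrt (-(khLam a β))|) * (1 / (2 * |Real.sqrt (-(khLam a β))|)) +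
        ‖((1 : ℂ) * (-1 / ((1 - starRingEnd ℂ (Complex.exp (2 * Real.pi * β * Complex.I)) * (Real.exp (-(2 * Real.pi * a)) : ℂ)) * (2 * (2 * Real.pi * a)))) * Complex.exp (-((2 * Real.pi * a : ℝ) : ℂ) * (1 / 4 : ℝ)))‖ * Real.exp ((2 * Real.pi * a) * (-(1 / 4 : ℝ))) * (2 + Real.pi) / |(2 * Real.pi * a)| * (1 / |(0 : ℝ) + (-(2 * Real.pi * a)) * (-(1 / 4 : ℝ)) - Real.sqrt (-(khLam a β))| + 1 / |(0 : ℝ) + (-(2 * Real.pi * a)) * (-(1 / 4 : ℝ)) + Real.sqrt (-(khLam a β))|) * (1 / (2 * |Real.sqrt (-(khLam a β))|))) +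
      (‖((1 : ℂ) * (-(Complex.exp (2 * Real.pi * β * Complex.I) * (Real.exp (-(2 * Real.pi * a)) : ℂ)) / ((1 - Complex.exp (2 * Real.pi * β * Complex.I) * (Real.exp (-(2 * Real.pi * a)) : ℂ)) * (2 * (2 * Real.pi * a)))) * Complex.exp (((2 * Real.pi * a : ℝ) : ℂ) * (1 / 4 : ℝ)))‖ * Real.exp ((-(2 * Real.pi * a)) * (1 / 4 : ℝ)) * (2 + Real.pi) / |(-(2 * Real.pi * a))| * (1 / |(0 : ℝ) + (-(2 * Real.pi * a)) * (1 / 4 : ℝ) - Real.sqrt (-(khLam a β))| + 1 / |(0 : ℝ) + (-(2 * Real.pi * a)) * (1 / 4 : ℝ) + Real.sqrt (-(khLam a β))|) * (1 / (2 * |Real.sqrt (-(khLam a β))|)) +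
        ‖((1 : ℂ) * (-(Complex.exp (2 * Real.pi * β * Complex.I) * (Real.exp (-(2 * Real.pi * a)) : ℂ)) / ((1 - Complex.exp (2 * Real.pi * β * Complex.I) * (Real.exp (-(2 * Real.pi * a)) : ℂ)) * (2 * (2 * Real.pi * a)))) * Complex.exp (((2 * Real.pi * a : ℝ) : ℂ) * (1 / 4 : ℝ)))‖ * Real.exp ((-(2 * Real.pi * a)) * (-(1 / 4 : ℝ))) * (2 + Real.pi) / |(-(2 * Real.pi * a))| * (1 / |(0 : ℝ) + (-(2 * Real.pi * a)) * (-(1 / 4 : ℝ)) - Real.sqrt (-(khLam a β))| + 1 / |(0 : ℝ) + (-(2 * Real.pi * a)) * (-(1 / 4 : ℝ)) + Real.sqrt (-(khLam a β))|) * (1 / (2 * |Real.sqrt (-(khLam a β))|)))) +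
      ((‖((starRingEnd ℂ (Complex.exp (2 * Real.pi * β * Complex.I))) * (-1 / ((1 - starRingEnd ℂ (Complex.exp (2 * Real.pi * β * Complex.I)) * (Real.exp (-(2 * Real.pi * a)) : ℂ)) * (2 * (2 * Real.pi * a)))) * Complex.exp (-((2 * Real.pi * a : ℝ) : ℂ) * (5 / 4 : ℝ)))‖ * Real.exp ((2 * Real.pi * a) * (1 / 2 : ℝ)) * (2 + Real.pi) / |(2 * Real.pi * a)| * (1 / |(-(Real.pi * a)) + (2 * Real.pi * a) * (1 / 2 : ℝ) - Real.sqrt (-(khLam a β))| + 1 / |(-(Real.pi * a)) + (2 * Real.pi * a) * (1 / 2 : ℝ) + Real.sqrt (-(khLam a β))|) * (1 / (2 * |Real.sqrt (-(khLam a β))|)) +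
        ‖((starRingEnd ℂ (Complex.exp (2 * Real.pi * β * Complex.I))) * (-1 / ((1 - starRingEnd ℂ (Complex.exp (2 * Real.pi * β * Complex.I)) * (Real.exp (-(2 * Real.pi * a)) : ℂ)) * (2 * (2 * Real.pi * a)))) * Complex.exp (-((2 * Real.pi * a : ℝ) : ℂ) * (5 / 4 : ℝ)))‖ * Real.exp ((2 * Real.pi * a) * (1 / 4 : ℝ)) * (2 + Real.pi) / |(2 * Real.pi * a)| * (1 / |(-(Real.pi * a)) + (2 * Real.pi * a) * (1 / 4 : ℝ) - Real.sqrt (-(khLam a β))| + 1 / |(-(Real.pi * a)) + (2 * Real.pi * a) * (1 / 4 : ℝ) + Real.sqrt (-(khLam a β))|) * (1 / (2 * |Real.sqrt (-(khLam a β))|))) +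
      (‖((starRingEnd ℂ (Complex.exp (2 * Real.pi * β * Complex.I))) * (-(Complex.exp (2 * Real.pi * β * Complex.I) * (Real.exp (-(2 * Real.pi * a)) : ℂ)) / ((1 - Complex.exp (2 * Real.pi * β * Complex.I) * (Real.exp (-(2 * Real.pi * a)) : ℂ)) * (2 * (2 * Real.pi * a)))) * Complex.exp (((2 * Real.pi * a : ℝ) : ℂ) * (5 / 4 : ℝ)))‖ * Real.exp ((-(2 * Real.pi * a)) * (1 / 2 : ℝ)) * (2 + Real.pi) / |(-(2 * Real.pi * a))| * (1 / |(-(Real.pi * a)) + (2 * Real.pi * a) * (1 / 2 : ℝ) - Real.sqrt (-(khLam a β))| + 1 / |(-(Real.pi * a)) + (2 * Real.pi * a) * (1 / 2 : ℝ) + Real.sqrt (-(khLam a β))|) * (1 / (2 * |Real.sqrt (-(khLam a β))|)) +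
        ‖((starRingEnd ℂ (Complex.exp (2 * Real.pi * β * Complex.I))) * (-(Complex.exp (2 * Real.pi * β * Complex.I) * (Real.exp (-(2 * Real.pi * a)) : ℂ)) / ((1 - Complex.exp (2 * Real.pi * β * Complex.I) * (Real.exp (-(2 * Real.pi * a)) : ℂ)) * (2 * (2 * Real.pi * a)))) * Complex.exp (((2 * Real.pi * a : ℝ) : ℂ) * (5 / 4 : ℝ)))‖ * Real.exp ((-(2 * Real.pi * a)) * (1 / 4 : ℝ)) * (2 + Real.pi) / |(-(2 * Real.pi * a))| * (1 / |(-(Real.pi * a)) + (2 * Real.pi * a) * (1 / 4 : ℝ) - Real.sqrt (-(khLam a β))| + 1 / |(-(Real.pi * a)) + (2 * Real.pi * a) * (1 / 4 : ℝ) + Real.sqrt (-(khLam a β))|) * (1 / (2 * |Real.sqrt (-(khLam a β))|))))) +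
      ‖blockX a β 0 1‖ * ‖(((2 * Real.pi * a : ℝ) * Complex.I : ℂ) * 2)‖ *
      (((‖((1 : ℂ) * (-1 / ((1 - starRingEnd ℂ (Complex.exp (2 * Real.pi * β * Complex.I)) * (Real.exp (-(2 * Real.pi * a)) : ℂ)) * (2 * (2 * Real.pi * a)))) * Complex.exp (-((2 * Real.pi * a : ℝ) : ℂ) * (-(1 / 4 : ℝ))))‖ * Real.exp ((2 * Real.pi * a) * (-(1 / 4 : ℝ))) * (2 + Real.pi) / |(2 * Real.pi * a)| * (1 / |(Real.pi * a) + (2 * Real.pi * a) * (-(1 / 4 : ℝ)) - Real.sqrt (-(khLam a β))| + 1 / |(Real.pi * a) + (2 * Real.pi * a) * (-(1 / 4 : ℝ)) + Real.sqrt (-(khLam a β))|) * (1 / (2 * |Real.sqrt (-(khLam a β))|)) +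
        ‖((1 : ℂ) * (-1 / ((1 - starRingEnd ℂ (Complex.exp (2 * Real.pi * β * Complex.I)) * (Real.exp (-(2 * Real.pi * a)) : ℂ)) * (2 * (2 * Real.pi * a)))) * Complex.exp (-((2 * Real.pi * a : ℝ) : ℂ) * (-(1 / 4 : ℝ))))‖ * Real.exp ((2 * Real.pi * a) * (-(1 / 2 : ℝ))) * (2 + Real.pi) / |(2 * Real.pi * a)| * (1 / |(Real.pi * a) + (2 * Real.pi * a) * (-(1 / 2 : ℝ)) - Real.sqrt (-(khLam a β))| + 1 / |(Real.pi * a) + (2 * Real.pi * a) * (-(1 / 2 : ℝ)) + Real.sqrt (-(khLam a β))|) * (1 / (2 * |Real.sqrt (-(khLam a β))|))) +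
      (‖((1 : ℂ) * (-(Complex.exp (2 * Real.pi * β * Complex.I) * (Real.exp (-(2 * Real.pi * a)) : ℂ)) / ((1 - Complex.exp (2 * Real.pi * β * Complex.I) * (Real.exp (-(2 * Real.pi * a)) : ℂ)) * (2 * (2 * Real.pi * a)))) * Complex.exp (((2 * Real.pi * a : ℝ) : ℂ) * (-(1 / 4 : ℝ))))‖ * Real.exp ((-(2 * Real.pi * a)) * (-(1 / 4 : ℝ))) * (2 + Real.pi) / |(-(2 * Real.pi * a))| * (1 / |(Real.pi * a) + (2 * Real.pi * a) * (-(1 / 4 : ℝ)) - Real.sqrt (-(khLam a β))| + 1 / |(Real.pi * a) + (2 * Real.pi * a) * (-(1 / 4 : ℝ)) + Real.sqrt (-(khLam a β))|) * (1 / (2 * |Real.sqrt (-(khLam a β))|)) +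
        ‖((1 : ℂ) * (-(Complex.exp (2 * Real.pi * β * Complex.I) * (Real.exp (-(2 * Real.pi * a)) : ℂ)) / ((1 - Complex.exp (2 * Real.pi * β * Complex.I) * (Real.exp (-(2 * Real.pi * a)) : ℂ)) * (2 * (2 * Real.pi * a)))) * Complex.exp (((2 * Real.pi * a : ℝ) : ℂ) * (-(1 / 4 : ℝ))))‖ * Real.exp ((-(2 * Real.pi * a)) * (-(1 / 2 : ℝ))) * (2 + Real.pi) / |(-(2 * Real.pi * a))| * (1 / |(Real.pi * a) + (2 * Real.pi * a) * (-(1 / 2 : ℝ)) - Real.sqrt (-(khLam a β))| + 1 / |(Real.pi * a) + (2 * Real.pi * a) * (-(1 / 2 : ℝ)) + Real.sqrt (-(khLam a β))|) * (1 / (2 * |Real.sqrt (-(khLam a β))|)))) +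
      ((‖((starRingEnd ℂ (Complex.exp (2 * Real.pi * β * Complex.I))) * (-1 / ((1 - starRingEnd ℂ (Complex.exp (2 * Real.pi * β * Complex.I)) * (Real.exp (-(2 * Real.pi * a)) : ℂ)) * (2 * (2 * Real.pi * a)))) * Complex.exp (-((2 * Real.pi * a : ℝ) : ℂ) * (3 / 4 : ℝ)))‖ * Real.exp ((2 * Real.pi * a) * (1 / 4 : ℝ)) * (2 + Real.pi) / |(2 * Real.pi * a)| * (1 / |(0 : ℝ) + (-(2 * Real.pi * a)) * (1 / 4 : ℝ) - Real.sqrt (-(khLam a β))| + 1 / |(0 : ℝ) + (-(2 * Real.pi * a)) * (1 / 4 : ℝ) + Real.sqrt (-(khLam a β))|) * (1 / (2 * |Real.sqrt (-(khLam a β))|)) +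
        ‖((starRingEnd ℂ (Complex.exp (2 * Real.pi * β * Complex.I))) * (-1 / ((1 - starRingEnd ℂ (Complex.exp (2 * Real.pi * β * Complex.I)) * (Real.exp (-(2 * Real.pi * a)) : ℂ)) * (2 * (2 * Real.pi * a)))) * Complex.exp (-((2 * Real.pi * a : ℝ) : ℂ) * (3 / 4 : ℝ)))‖ * Real.exp ((2 * Real.pi * a) * (-(1 / 4 : ℝ))) * (2 + Real.pi) / |(2 * Real.pi * a)| * (1 / |(0 : ℝ) + (-(2 * Real.pi * a)) * (-(1 / 4 : ℝ)) - Real.sqrt (-(khLam a β))| + 1 / |(0 : ℝ) + (-(2 * Real.pi * a)) * (-(1 / 4 : ℝ)) + Real.sqrt (-(khLam a β))|) * (1 / (2 * |Real.sqrt (-(khLam a β))|))) +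
      (‖((starRingEnd ℂ (Complex.exp (2 * Real.pi * β * Complex.I))) * (-(Complex.exp (2 * Real.pi * β * Complex.I) * (Real.exp (-(2 * Real.pi * a)) : ℂ)) / ((1 - Complex.exp (2 * Real.pi * β * Complex.I) * (Real.exp (-(2 * Real.pi * a)) : ℂ)) * (2 * (2 * Real.pi * a)))) * Complex.exp (((2 * Real.pi * a : ℝ) : ℂ) * (3 / 4 : ℝ)))‖ * Real.exp ((-(2 * Real.pi * a)) * (1 / 4 : ℝ)) * (2 + Real.pi) / |(-(2 * Real.pi * a))| * (1 / |(0 : ℝ) + (-(2 * Real.pi * a)) * (1 / 4 : ℝ) - Real.sqrt (-(khLam a β))| + 1 / |(0 : ℝ) + (-(2 * Real.pi * a)) * (1 / 4 : ℝ) + Real.sqrt (-(khLam a β))|) * (1 / (2 * |Real.sqrt (-(khLam a β))|)) +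
        ‖((starRingEnd ℂ (Complex.exp (2 * Real.pi * β * Complex.I))) * (-(Complex.exp (2 * Real.pi * β * Complex.I) * (Real.exp (-(2 * Real.pi * a)) : ℂ)) / ((1 - Complex.exp (2 * Real.pi * β * Complex.I) * (Real.exp (-(2 * Real.pi * a)) : ℂ)) * (2 * (2 * Real.pi * a)))) * Complex.exp (((2 * Real.pi * a : ℝ) : ℂ) * (3 / 4 : ℝ)))‖ * Real.exp ((-(2 * Real.pi * a)) * (-(1 / 4 : ℝ))) * (2 + Real.pi) / |(-(2 * Real.pi * a))| * (1 / |(0 : ℝ) + (-(2 * Real.pi * a)) * (-(1 / 4 : ℝ)) - Real.sqrt (-(khLam a β))| + 1 / |(0 : ℝ) + (-(2 * Real.pi * a)) * (-(1 / 4 : ℝ)) + Real.sqrt (-(khLam a β))|) * (1 / (2 * |Real.sqrt (-(khLam a β))|)))) +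
      ((‖((starRingEnd ℂ (Complex.exp (2 * Real.pi * β * Complex.I))) * (-1 / ((1 - starRingEnd ℂ (Complex.exp (2 * Real.pi * β * Complex.I)) * (Real.exp (-(2 * Real.pi * a)) : ℂ)) * (2 * (2 * Real.pi * a)))) * Complex.exp (-((2 * Real.pi * a : ℝ) : ℂ) * (3 / 4 : ℝ)))‖ * Real.exp ((2 * Real.pi * a) * (1 / 2 : ℝ)) * (2 + Real.pi) / |(2 * Real.pi * a)| * (1 / |(-(Real.pi * a)) + (2 * Real.pi * a) * (1 / 2 : ℝ) - Real.sqrt (-(khLam a β))| + 1 / |(-(Real.pi * a)) + (2 * Real.pi * a) * (1 / 2 : ℝ) + Real.sqrt (-(khLam a β))|) * (1 / (2 * |Real.sqrt (-(khLam a β))|)) +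
        ‖((starRingEnd ℂ (Complex.exp (2 * Real.pi * β * Complex.I))) * (-1 / ((1 - starRingEnd ℂ (Complex.exp (2 * Real.pi * β * Complex.I)) * (Real.exp (-(2 * Real.pi * a)) : ℂ)) * (2 * (2 * Real.pi * a)))) * Complex.exp (-((2 * Real.pi * a : ℝ) : ℂ) * (3 / 4 : ℝ)))‖ * Real.exp ((2 * Real.pi * a) * (1 / 4 : ℝ)) * (2 + Real.pi) / |(2 * Real.pi * a)| * (1 / |(-(Real.pi * a)) + (2 * Real.pi * a) * (1 / 4 : ℝ) - Real.sqrt (-(khLam a β))| + 1 / |(-(Real.pi * a)) + (2 * Real.pi * a) * (1 / 4 : ℝ) + Real.sqrt (-(khLam a β))|) * (1 / (2 * |Real.sqrt (-(khLam a β))|))) +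
      (‖((starRingEnd ℂ (Complex.exp (2 * Real.pi * β * Complex.I))) * (-(Complex.exp (2 * Real.pi * β * Complex.I) * (Real.exp (-(2 * Real.pi * a)) : ℂ)) / ((1 - Complex.exp (2 * Real.pi * β * Complex.I) * (Real.exp (-(2 * Real.pi * a)) : ℂ)) * (2 * (2 * Real.pi * a)))) * Complex.exp (((2 * Real.pi * a : ℝ) : ℂ) * (3 / 4 : ℝ)))‖ * Real.exp ((-(2 * Real.pi * a)) * (1 / 2 : ℝ)) * (2 + Real.pi) / |(-(2 * Real.pi * a))| * (1 / |(-(Real.pi * a)) + (2 * Real.pi * a) * (1 / 2 : ℝ) - Real.sqrt (-(khLam a β))| + 1 / |(-(Real.pi * a)) + (2 * Real.pi * a) * (1 / 2 : ℝ) + Real.sqrt (-(khLam a β))|) * (1 / (2 * |Real.sqrt (-(khLam a β))|)) +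
        ‖((starRingEnd ℂ (Complex.exp (2 * Real.pi * β * Complex.I))) * (-(Complex.exp (2 * Real.pi * β * Complex.I) * (Real.exp (-(2 * Real.pi * a)) : ℂ)) / ((1 - Complex.exp (2 * Real.pi * β * Complex.I) * (Real.exp (-(2 * Real.pi * a)) : ℂ)) * (2 * (2 * Real.pi * a)))) * Complex.exp (((2 * Real.pi * a : ℝ) : ℂ) * (3 / 4 : ℝ)))‖ * Real.exp ((-(2 * Real.pi * a)) * (1 / 4 : ℝ)) * (2 + Real.pi) / |(-(2 * Real.pi * a))| * (1 / |(-(Real.pi * a)) + (2 * Real.pi * a) * (1 / 4 : ℝ) - Real.sqrt (-(khLam a β))| + 1 / |(-(Real.pi * a)) + (2 * Real.pi * a) * (1 / 4 : ℝ) + Real.sqrt (-(khLam a β))|) * (1 / (2 * |Real.sqrt (-(khLam a β))|))))) := by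
  have ha0 : 0 < a := by linarith
  obtain ⟨_, _, hω, hω1, hω2⟩ := sheetAmps_rate_window ha β
  rw [sheetAmps_singleMode_apply_0 ha]
  have hBc := norm_integral_cos_src_quarter_le ha0 β ξ hθ hω hω1 hω2 (K := kernelK a β) rfl (lineKernel_eq ha0 β)
  have hBs0 := norm_integral_sin_src_quarter_le ha0 β ξ hθ hω hω1 hω2 (K := kernelK a β) rfl (lineKernel_eq ha0 β)
  have hBs1 := norm_integral_sin_src_negQuarter_le ha0 β ξ hθ hω hω1 hω2 (K := kernelK a β) rfl (lineKernel_eq ha0 β)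
  exact norm_component_zero_le (kc := fun s => Real.cos (Real.sqrt (-(khLam a β)) * (θ - s))) (ks := fun s => Real.sin (Real.sqrt (-(khLam a β)) * (θ - s)) / Real.sqrt (-(khLam a β)))
    (by fun_prop) (by fun_prop) (continuous_src ha0 β ξ (Or.inl rfl)) (continuous_src ha0 β ξ (Or.inr rfl)) (((2 * Real.pi * a : ℝ) * Complex.I : ℂ) * (-2)) (((2 * Real.pi * a : ℝ) * Complex.I : ℂ) * 2)
    (blockX a β 0 0) (blockX a β 0 1) hBc hBs0 hBs1

/-- **Single-mode stable-block creation, component `1`, BY NAME** (`a ≥ 1`, `θ ≥ 0`, any `β`, `ξ`): `‖sheetAmps a β θ (singleMode ξ) 1‖` is at most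
`‖c_1‖·Bc + ‖X_10‖‖c₀‖·Bs₀ + ‖X_11‖‖c₁‖·Bs₁` with the tree's explicit twelve-term bounds (`ω = √(−λ) ∈ [0.55a, πa/2 − 399/401]`). -/
theorem sheetAmps_singleMode_norm_le_1 {a : ℝ} (ha : 1 ≤ a) (β ξ : ℝ) {θ : ℝ} (hθ : 0 ≤ θ) :
    ‖sheetAmps a β θ (singleMode ξ) 1‖ ≤
      ‖(((2 * Real.pi * a : ℝ) * Complex.I : ℂ) * 2)‖ *
      (((‖((1 : ℂ) * (-1 / ((1 - starRingEnd ℂ (Complex.exp (2 * Real.pi * β * Complex.I)) * (Real.exp (-(2 * Real.pi * a)) : ℂ)) * (2 * (2 * Real.pi * a)))) * Complex.exp (-((2 * Real.pi * a : ℝ) : ℂ) * (-(1 / 4 : ℝ))))‖ * Real.exp ((2 * Real.pi * a) * (-(1 / 4 : ℝ))) * (2 + Real.pi) / |(2 * Real.pi * a)| * (1 / |(Real.pi * a) + (2 * Real.pi * a) * (-(1 / 4 : ℝ)) - Real.sqrt (-(khLam a β))| + 1 / |(Real.pi * a) + (2 * Real.pi * a) * (-(1 / 4 : ℝ)) + Real.sqrt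 (-(khLam a β))|) * (1 / 2) +
        ‖((1 : ℂ) * (-1 / ((1 - starRingEnd ℂ (Complex.exp (2 * Real.pi * β * Complex.I)) * (Real.exp (-(2 * Real.pi * a)) : ℂ)) * (2 * (2 * Real.pi * a)))) * Complex.exp (-((2 * Real.pi * a : ℝ) : ℂ) * (-(1 / 4 : ℝ))))‖ * Real.exp ((2 * Real.pi * a) * (-(1 / 2 : ℝ))) * (2 + Real.pi) / |(2 * Real.pi * a)| * (1 / |(Real.pi * a) + (2 * Real.pi * a) * (-(1 / 2 : ℝ)) - Real.sqrt (-(khLam a β))| + 1 / |(Real.pi * a) + (2 * Real.pi * a) * (-(1 / 2 : ℝ)) + Real.sqrt (-(khLam a β))|) * (1 / 2)) +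
      (‖((1 : ℂ) * (-(Complex.exp (2 * Real.pi * β * Complex.I) * (Real.exp (-(2 * Real.pi * a)) : ℂ)) / ((1 - Complex.exp (2 * Real.pi * β * Complex.I) * (Real.exp (-(2 * Real.pi * a)) : ℂ)) * (2 * (2 * Real.pi * a)))) * Complex.exp (((2 * Real.pi * a : ℝ) : ℂ) * (-(1 / 4 : ℝ))))‖ * Real.exp ((-(2 * Real.pi * a)) * (-(1 / 4 : ℝ))) * (2 + Real.pi) / |(-(2 * Real.pi * a))| * (1 / |(Real.pi * a) + (2 * Real.pi * a) * (-(1 / 4 : ℝ)) - Real.sqrt (-(khLam a β))| + 1 / |(Real.pi * a) + (2 * Real.pi * a) * (-(1 / 4 : ℝ)) + Real.sqrt (-(khLam a β))|) * (1 / 2) +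
        ‖((1 : ℂ) * (-(Complex.exp (2 * Real.pi * β * Complex.I) * (Real.exp (-(2 * Real.pi * a)) : ℂ)) / ((1 - Complex.exp (2 * Real.pi * β * Complex.I) * (Real.exp (-(2 * Real.pi * a)) : ℂ)) * (2 * (2 * Real.pi * a)))) * Complex.exp (((2 * Real.pi * a : ℝ) : ℂ) * (-(1 / 4 : ℝ))))‖ * Real.exp ((-(2 * Real.pi * a)) * (-(1 / 2 : ℝ))) * (2 + Real.pi) / |(-(2 * Real.pi * a))| * (1 / |(Real.pi * a) + (2 * Real.pi * a) * (-(1 / 2 : ℝ)) - Real.sqrt (-(khLam a β))| + 1 / |(Real.pi * a) + (2 * Real.pi * a) * (-(1 / 2 : ℝ)) + Real.sqrt (-(khLam a β))|) * (1 / 2))) +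
      ((‖((starRingEnd ℂ (Complex.exp (2 * Real.pi * β * Complex.I))) * (-1 / ((1 - starRingEnd ℂ (Complex.exp (2 * Real.pi * β * Complex.I)) * (Real.exp (-(2 * Real.pi * a)) : ℂ)) * (2 * (2 * Real.pi * a)))) * Complex.exp (-((2 * Real.pi * a : ℝ) : ℂ) * (3 / 4 : ℝ)))‖ * Real.exp ((2 * Real.pi * a) * (1 / 4 : ℝ)) * (2 + Real.pi) / |(2 * Real.pi * a)| * (1 / |(0 : ℝ) + (-(2 * Real.pi * a)) * (1 / 4 : ℝ) - Real.sqrt (-(khLam a β))| + 1 / |(0 : ℝ) + (-(2 * Real.pi * a)) * (1 / 4 : ℝ) + Real.sqrt (-(khLam a β))|) * (1 / 2) +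
        ‖((starRingEnd ℂ (Complex.exp (2 * Real.pi * β * Complex.I))) * (-1 / ((1 - starRingEnd ℂ (Complex.exp (2 * Real.pi * β * Complex.I)) * (Real.exp (-(2 * Real.pi * a)) : ℂ)) * (2 * (2 * Real.pi * a)))) * Complex.exp (-((2 * Real.pi * a : ℝ) : ℂ) * (3 / 4 : ℝ)))‖ * Real.exp ((2 * Real.pi * a) * (-(1 / 4 : ℝ))) * (2 + Real.pi) / |(2 * Real.pi * a)| * (1 / |(0 : ℝ) + (-(2 * Real.pi * a)) * (-(1 / 4 : ℝ)) - Real.sqrt (-(khLam a β))| + 1 / |(0 : ℝ) + (-(2 * Real.pi * a)) * (-(1 / 4 : ℝ)) + Real.sqrt (-(khLam a β))|) * (1 / 2)) +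
      (‖((starRingEnd ℂ (Complex.exp (2 * Real.pi * β * Complex.I))) * (-(Complex.exp (2 * Real.pi * β * Complex.I) * (Real.exp (-(2 * Real.pi * a)) : ℂ)) / ((1 - Complex.exp (2 * Real.pi * β * Complex.I) * (Real.exp (-(2 * Real.pi * a)) : ℂ)) * (2 * (2 * Real.pi * a)))) * Complex.exp (((2 * Real.pi * a : ℝ) : ℂ) * (3 / 4 : ℝ)))‖ * Real.exp ((-(2 * Real.pi * a)) * (1 / 4 : ℝ)) * (2 + Real.pi) / |(-(2 * Real.pi * a))| * (1 / |(0 : ℝ) + (-(2 * Real.pi * a)) * (1 / 4 : ℝ) - Real.sqrt (-(khLam a β))| + 1 / |(0 : ℝ) + (-(2 * Real.pi * a)) * (1 / 4 : ℝ) + Real.sqrt (-(khLam a β))|) * (1 / 2) +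
        ‖((starRingEnd ℂ (Complex.exp (2 * Real.pi * β * Complex.I))) * (-(Complex.exp (2 * Real.pi * β * Complex.I) * (Real.exp (-(2 * Real.pi * a)) : ℂ)) / ((1 - Complex.exp (2 * Real.pi * β * Complex.I) * (Real.exp (-(2 * Real.pi * a)) : ℂ)) * (2 * (2 * Real.pi * a)))) * Complex.exp (((2 * Real.pi * a : ℝ) : ℂ) * (3 / 4 : ℝ)))‖ * Real.exp ((-(2 * Real.pi * a)) * (-(1 / 4 : ℝ))) * (2 + Real.pi) / |(-(2 * Real.pi * a))| * (1 / |(0 : ℝ) + (-(2 * Real.pi * a)) * (-(1 / 4 : ℝ)) - Real.sqrt (-(khLam a β))| + 1 / |(0 : ℝ) + (-(2 * Real.pi * a)) * (-(1 / 4 : ℝ)) + Real.sqrt (-(khLam a β))|) * (1 / 2))) +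
      ((‖((starRingEnd ℂ (Complex.exp (2 * Real.pi * β * Complex.I))) * (-1 / ((1 - starRingEnd ℂ (Complex.exp (2 * Real.pi * β * Complex.I)) * (Real.exp (-(2 * Real.pi * a)) : ℂ)) * (2 * (2 * Real.pi * a)))) * Complex.exp (-((2 * Real.pi * a : ℝ) : ℂ) * (3 / 4 : ℝ)))‖ * Real.exp ((2 * Real.pi * a) * (1 / 2 : ℝ)) * (2 + Real.pi) / |(2 * Real.pi * a)| * (1 / |(-(Real.pi * a)) + (2 * Real.pi * a) * (1 / 2 : ℝ) - Real.sqrt (-(khLam a β))| + 1 / |(-(Real.pi * a)) + (2 * Real.pi * a) * (1 / 2 : ℝ) + Real.sqrt (-(khLam a β))|) * (1 / 2) +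
        ‖((starRingEnd ℂ (Complex.exp (2 * Real.pi * β * Complex.I))) * (-1 / ((1 - starRingEnd ℂ (Complex.exp (2 * Real.pi * β * Complex.I)) * (Real.exp (-(2 * Real.pi * a)) : ℂ)) * (2 * (2 * Real.pi * a)))) * Complex.exp (-((2 * Real.pi * a : ℝ) : ℂ) * (3 / 4 : ℝ)))‖ * Real.exp ((2 * Real.pi * a) * (1 / 4 : ℝ)) * (2 + Real.pi) / |(2 * Real.pi * a)| * (1 / |(-(Real.pi * a)) + (2 * Real.pi * a) * (1 / 4 : ℝ) - Real.sqrt (-(khLam a β))| + 1 / |(-(Real.pi * a)) + (2 * Real.pi * a) * (1 / 4 : ℝ) + Real.sqrt (-(khLam a β))|) * (1 / 2)) +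
      (‖((starRingEnd ℂ (Complex.exp (2 * Real.pi * β * Complex.I))) * (-(Complex.exp (2 * Real.pi * β * Complex.I) * (Real.exp (-(2 * Real.pi * a)) : ℂ)) / ((1 - Complex.exp (2 * Real.pi * β * Complex.I) * (Real.exp (-(2 * Real.pi * a)) : ℂ)) * (2 * (2 * Real.pi * a)))) * Complex.exp (((2 * Real.pi * a : ℝ) : ℂ) * (3 / 4 : ℝ)))‖ * Real.exp ((-(2 * Real.pi * a)) * (1 / 2 : ℝ)) * (2 + Real.pi) / |(-(2 * Real.pi * a))| * (1 / |(-(Real.pi * a)) + (2 * Real.pi * a) * (1 / 2 : ℝ) - Real.sqrt (-(khLam a β))| + 1 / |(-(Real.pi * a)) + (2 * Real.pi * a) * (1 / 2 : ℝ) + Real.sqrt (-(khLam a β))|) * (1 / 2) +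
        ‖((starRingEnd ℂ (Complex.exp (2 * Real.pi * β * Complex.I))) * (-(Complex.exp (2 * Real.pi * β * Complex.I) * (Real.exp (-(2 * Real.pi * a)) : ℂ)) / ((1 - Complex.exp (2 * Real.pi * β * Complex.I) * (Real.exp (-(2 * Real.pi * a)) : ℂ)) * (2 * (2 * Real.pi * a)))) * Complex.exp (((2 * Real.pi * a : ℝ) : ℂ) * (3 / 4 : ℝ)))‖ * Real.exp ((-(2 * Real.pi * a)) * (1 / 4 : ℝ)) * (2 + Real.pi) / |(-(2 * Real.pi * a))| * (1 / |(-(Real.pi * a)) + (2 * Real.pi * a) * (1 / 4 : ℝ) - Real.sqrt (-(khLam a β))| + 1 / |(-(Real.pi * a)) + (2 * Real.pi * a) * (1 / 4 : ℝ) + Real.sqrt (-(khLam a β))|) * (1 / 2)))) +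
      ‖blockX a β 1 0‖ * ‖(((2 * Real.pi * a : ℝ) * Complex.I : ℂ) * (-2))‖ *
      (((‖((1 : ℂ) * (-1 / ((1 - starRingEnd ℂ (Complex.exp (2 * Real.pi * β * Complex.I)) * (Real.exp (-(2 * Real.pi * a)) : ℂ)) * (2 * (2 * Real.pi * a)))) * Complex.exp (-((2 * Real.pi * a : ℝ) : ℂ) * (1 / 4 : ℝ)))‖ * Real.exp ((2 * Real.pi * a) * (-(1 / 4 : ℝ))) * (2 + Real.pi) / |(2 * Real.pi * a)| * (1 / |(Real.pi * a) + (2 * Real.pi * a) * (-(1 / 4 : ℝ)) - Real.sqrt (-(khLam a β))| + 1 / |(Real.pi * a) + (2 * Real.pi * a) * (-(1 / 4 : ℝ)) + Real.sqrt (-(khLam a β))|) * (1 / (2 * |Real.sqrt (-(khLam a β))|)) +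
        ‖((1 : ℂ) * (-1 / ((1 - starRingEnd ℂ (Complex.exp (2 * Real.pi * β * Complex.I)) * (Real.exp (-(2 * Real.pi * a)) : ℂ)) * (2 * (2 * Real.pi * a)))) * Complex.exp (-((2 * Real.pi * a : ℝ) : ℂ) * (1 / 4 : ℝ)))‖ * Real.exp ((2 * Real.pi * a) * (-(1 / 2 : ℝ))) * (2 + Real.pi) / |(2 * Real.pi * a)| * (1 / |(Real.pi * a) + (2 * Real.pi * a) * (-(1 / 2 : ℝ)) - Real.sqrt (-(khLam a β))| + 1 / |(Real.pi * a) + (2 * Real.pi * a) * (-(1 / 2 : ℝ)) + Real.sqrt (-(khLam a β))|) * (1 / (2 * |Real.sqrt (-(khLam a β))|))) +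
      (‖((1 : ℂ) * (-(Complex.exp (2 * Real.pi * β * Complex.I) * (Real.exp (-(2 * Real.pi * a)) : ℂ)) / ((1 - Complex.exp (2 * Real.pi * β * Complex.I) * (Real.exp (-(2 * Real.pi * a)) : ℂ)) * (2 * (2 * Real.pi * a)))) * Complex.exp (((2 * Real.pi * a : ℝ) : ℂ) * (1 / 4 : ℝ)))‖ * Real.exp ((-(2 * Real.pi * a)) * (-(1 / 4 : ℝ))) * (2 + Real.pi) / |(-(2 * Real.pi * a))| * (1 / |(Real.pi * a) + (2 * Real.pi * a) * (-(1 / 4 : ℝ)) - Real.sqrt (-(khLam a β))| + 1 / |(Real.pi * a) + (2 * Real.pi * a) * (-(1 / 4 : ℝ)) + Real.sqrt (-(khLam a β))|) * (1 / (2 * |Real.sqrt (-(khLam a β))|)) +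
        ‖((1 : ℂ) * (-(Complex.exp (2 * Real.pi * β * Complex.I) * (Real.exp (-(2 * Real.pi * a)) : ℂ)) / ((1 - Complex.exp (2 * Real.pi * β * Complex.I) * (Real.exp (-(2 * Real.pi * a)) : ℂ)) * (2 * (2 * Real.pi * a)))) * Complex.exp (((2 * Real.pi * a : ℝ) : ℂ) * (1 / 4 : ℝ)))‖ * Real.exp ((-(2 * Real.pi * a)) * (-(1 / 2 : ℝ))) * (2 + Real.pi) / |(-(2 * Real.pi * a))| * (1 / |(Real.pi * a) + (2 * Real.pi * a) * (-(1 / 2 : ℝ)) - Real.sqrt (-(khLam a β))| + 1 / |(Real.pi * a) + (2 * Real.pi * a) * (-(1 / 2 : ℝ)) + Real.sqrt (-(khLam a β))|) * (1 / (2 * |Real.sqrt (-(khLam a β))|)))) +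
      ((‖((1 : ℂ) * (-1 / ((1 - starRingEnd ℂ (Complex.exp (2 * Real.pi * β * Complex.I)) * (Real.exp (-(2 * Real.pi * a)) : ℂ)) * (2 * (2 * Real.pi * a)))) * Complex.exp (-((2 * Real.pi * a : ℝ) : ℂ) * (1 / 4 : ℝ)))‖ * Real.exp ((2 * Real.pi * a) * (1 / 4 : ℝ)) * (2 + Real.pi) / |(2 * Real.pi * a)| * (1 / |(0 : ℝ) + (-(2 * Real.pi * a)) * (1 / 4 : ℝ) - Real.sqrt (-(khLam a β))| + 1 / |(0 : ℝ) + (-(2 * Real.pi * a)) * (1 / 4 : ℝ) + Real.sqrt (-(khLam a β))|) * (1 / (2 * |Real.sqrt (-(khLam a β))|)) +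
        ‖((1 : ℂ) * (-1 / ((1 - starRingEnd ℂ (Complex.exp (2 * Real.pi * β * Complex.I)) * (Real.exp (-(2 * Real.pi * a)) : ℂ)) * (2 * (2 * Real.pi * a)))) * Complex.exp (-((2 * Real.pi * a : ℝ) : ℂ) * (1 / 4 : ℝ)))‖ * Real.exp ((2 * Real.pi * a) * (-(1 / 4 : ℝ))) * (2 + Real.pi) / |(2 * Real.pi * a)| * (1 / |(0 : ℝ) + (-(2 * Real.pi * a)) * (-(1 / 4 : ℝ)) - Real.sqrt (-(khLam a β))| + 1 / |(0 : ℝ) + (-(2 * Real.pi * a)) * (-(1 / 4 : ℝ)) + Real.sqrt (-(khLam a β))|) * (1 / (2 * |Real.sqrt (-(khLam a β))|))) +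
      (‖((1 : ℂ) * (-(Complex.exp (2 * Real.pi * β * Complex.I) * (Real.exp (-(2 * Real.pi * a)) : ℂ)) / ((1 - Complex.exp (2 * Real.pi * β * Complex.I) * (Real.exp (-(2 * Real.pi * a)) : ℂ)) * (2 * (2 * Real.pi * a)))) * Complex.exp (((2 * Real.pi * a : ℝ) : ℂ) * (1 / 4 : ℝ)))‖ * Real.exp ((-(2 * Real.pi * a)) * (1 / 4 : ℝ)) * (2 + Real.pi) / |(-(2 * Real.pi * a))| * (1 / |(0 : ℝ) + (-(2 * Real.pi * a)) * (1 / 4 : ℝ) - Real.sqrt (-(khLam a β))| + 1 / |(0 : ℝ) + (-(2 * Real.pi * a)) * (1 / 4 : ℝ) + Real.sqrt (-(khLam a β))|) * (1 / (2 * |Real.sqrt (-(khLam a β))|)) +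
        ‖((1 : ℂ) * (-(Complex.exp (2 * Real.pi * β * Complex.I) * (Real.exp (-(2 * Real.pi * a)) : ℂ)) / ((1 - Complex.exp (2 * Real.pi * β * Complex.I) * (Real.exp (-(2 * Real.pi * a)) : ℂ)) * (2 * (2 * Real.pi * a)))) * Complex.exp (((2 * Real.pi * a : ℝ) : ℂ) * (1 / 4 : ℝ)))‖ * Real.exp ((-(2 * Real.pi * a)) * (-(1 / 4 : ℝ))) * (2 + Real.pi) / |(-(2 * Real.pi * a))| * (1 / |(0 : ℝ) + (-(2 * Real.pi * a)) * (-(1 / 4 : ℝ)) - Real.sqrt (-(khLam a β))| + 1 / |(0 : ℝ) + (-(2 * Real.pi * a)) * (-(1 / 4 : ℝ)) + Real.sqrt (-(khLam a β))|) * (1 / (2 * |Real.sqrt (-(khLam a β))|)))) +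
      ((‖((starRingEnd ℂ (Complex.exp (2 * Real.pi * β * Complex.I))) * (-1 / ((1 - starRingEnd ℂ (Complex.exp (2 * Real.pi * β * Complex.I)) * (Real.exp (-(2 * Real.pi * a)) : ℂ)) * (2 * (2 * Real.pi * a)))) * Complex.exp (-((2 * Real.pi * a : ℝ) : ℂ) * (5 / 4 : ℝ)))‖ * Real.exp ((2 * Real.pi * a) * (1 / 2 : ℝ)) * (2 + Real.pi) / |(2 * Real.pi * a)| * (1 / |(-(Real.pi * a)) + (2 * Real.pi * a) * (1 / 2 : ℝ) - Real.sqrt (-(khLam a β))| + 1 / |(-(Real.pi * a)) + (2 * Real.pi * a) * (1 / 2 : ℝ) + Real.sqrt (-(khLam a β))|) * (1 / (2 * |Real.sqrt (-(khLam a β))|)) +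
        ‖((starRingEnd ℂ (Complex.exp (2 * Real.pi * β * Complex.I))) * (-1 / ((1 - starRingEnd ℂ (Complex.exp (2 * Real.pi * β * Complex.I)) * (Real.exp (-(2 * Real.pi * a)) : ℂ)) * (2 * (2 * Real.pi * a)))) * Complex.exp (-((2 * Real.pi * a : ℝ) : ℂ) * (5 / 4 : ℝ)))‖ * Real.exp ((2 * Real.pi * a) * (1 / 4 : ℝ)) * (2 + Real.pi) / |(2 * Real.pi * a)| * (1 / |(-(Real.pi * a)) + (2 * Real.pi * a) * (1 / 4 : ℝ) - Real.sqrt (-(khLam a β))| + 1 / |(-(Real.pi * a)) + (2 * Real.pi * a) * (1 / 4 : ℝ) + Real.sqrt (-(khLam a β))|) * (1 / (2 * |Real.sqrt (-(khLam a β))|))) +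
      (‖((starRingEnd ℂ (Complex.exp (2 * Real.pi * β * Complex.I))) * (-(Complex.exp (2 * Real.pi * β * Complex.I) * (Real.exp (-(2 * Real.pi * a)) : ℂ)) / ((1 - Complex.exp (2 * Real.pi * β * Complex.I) * (Real.exp (-(2 * Real.pi * a)) : ℂ)) * (2 * (2 * Real.pi * a)))) * Complex.exp (((2 * Real.pi * a : ℝ) : ℂ) * (5 / 4 : ℝ)))‖ * Real.exp ((-(2 * Real.pi * a)) * (1 / 2 : ℝ)) * (2 + Real.pi) / |(-(2 * Real.pi * a))| * (1 / |(-(Real.pi * a)) + (2 * Real.pi * a) * (1 / 2 : ℝ) - Real.sqrt (-(khLam a β))| + 1 / |(-(Real.pi * a)) + (2 * Real.pi * a) * (1 / 2 : ℝ) + Real.sqrt (-(khLam a β))|) * (1 / (2 * |Real.sqrt (-(khLam a β))|)) +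
        ‖((starRingEnd ℂ (Complex.exp (2 * Real.pi * β * Complex.I))) * (-(Complex.exp (2 * Real.pi * β * Complex.I) * (Real.exp (-(2 * Real.pi * a)) : ℂ)) / ((1 - Complex.exp (2 * Real.pi * β * Complex.I) * (Real.exp (-(2 * Real.pi * a)) : ℂ)) * (2 * (2 * Real.pi * a)))) * Complex.exp (((2 * Real.pi * a : ℝ) : ℂ) * (5 / 4 : ℝ)))‖ * Real.exp ((-(2 * Real.pi * a)) * (1 / 4 : ℝ)) * (2 + Real.pi) / |(-(2 * Real.pi * a))| * (1 / |(-(Real.pi * a)) + (2 * Real.pi * a) * (1 / 4 : ℝ) - Real.sqrt (-(khLam a β))| + 1 / |(-(Real.pi * a)) + (2 * Real.pi * a) * (1 / 4 : ℝ) + Real.sqrt (-(khLam a β))|) * (1 / (2 * |Real.sqrt (-(khLam a β))|))))) +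
      ‖blockX a β 1 1‖ * ‖(((2 * Real.pi * a : ℝ) * Complex.I : ℂ) * 2)‖ *
      (((‖((1 : ℂ) * (-1 / ((1 - starRingEnd ℂ (Complex.exp (2 * Real.pi * β * Complex.I)) * (Real.exp (-(2 * Real.pi * a)) : ℂ)) * (2 * (2 * Real.pi * a)))) * Complex.exp (-((2 * Real.pi * a : ℝ) : ℂ) * (-(1 / 4 : ℝ))))‖ * Real.exp ((2 * Real.pi * a) * (-(1 / 4 : ℝ))) * (2 + Real.pi) / |(2 * Real.pi * a)| * (1 / |(Real.pi * a) + (2 * Real.pi * a) * (-(1 / 4 : ℝ)) - Real.sqrt (-(khLam a β))| + 1 / |(Real.pi * a) + (2 * Real.pi * a) * (-(1 / 4 : ℝ)) + Real.sqrt (-(khLam a β))|) * (1 / (2 * |Real.sqrt (-(khLam a β))|)) +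
        ‖((1 : ℂ) * (-1 / ((1 - starRingEnd ℂ (Complex.exp (2 * Real.pi * β * Complex.I)) * (Real.exp (-(2 * Real.pi * a)) : ℂ)) * (2 * (2 * Real.pi * a)))) * Complex.exp (-((2 * Real.pi * a : ℝ) : ℂ) * (-(1 / 4 : ℝ))))‖ * Real.exp ((2 * Real.pi * a) * (-(1 / 2 : ℝ))) * (2 + Real.pi) / |(2 * Real.pi * a)| * (1 / |(Real.pi * a) + (2 * Real.pi * a) * (-(1 / 2 : ℝ)) - Real.sqrt (-(khLam a β))| + 1 / |(Real.pi * a) + (2 * Real.pi * a) * (-(1 / 2 : ℝ)) + Real.sqrt (-(khLam a β))|) * (1 / (2 * |Real.sqrt (-(khLam a β))|))) +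
      (‖((1 : ℂ) * (-(Complex.exp (2 * Real.pi * β * Complex.I) * (Real.exp (-(2 * Real.pi * a)) : ℂ)) / ((1 - Complex.exp (2 * Real.pi * β * Complex.I) * (Real.exp (-(2 * Real.pi * a)) : ℂ)) * (2 * (2 * Real.pi * a)))) * Complex.exp (((2 * Real.pi * a : ℝ) : ℂ) * (-(1 / 4 : ℝ))))‖ * Real.exp ((-(2 * Real.pi * a)) * (-(1 / 4 : ℝ))) * (2 + Real.pi) / |(-(2 * Real.pi * a))| * (1 / |(Real.pi * a) + (2 * Real.pi * a) * (-(1 / 4 : ℝ)) - Real.sqrt (-(khLam a β))| + 1 / |(Real.pi * a) + (2 * Real.pi * a) * (-(1 / 4 : ℝ)) + Real.sqrt (-(khLam a β))|) * (1 / (2 * |Real.sqrt (-(khLam a β))|)) +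
        ‖((1 : ℂ) * (-(Complex.exp (2 * Real.pi * β * Complex.I) * (Real.exp (-(2 * Real.pi * a)) : ℂ)) / ((1 - Complex.exp (2 * Real.pi * β * Complex.I) * (Real.exp (-(2 * Real.pi * a)) : ℂ)) * (2 * (2 * Real.pi * a)))) * Complex.exp (((2 * Real.pi * a : ℝ) : ℂ) * (-(1 / 4 : ℝ))))‖ * Real.exp ((-(2 * Real.pi * a)) * (-(1 / 2 : ℝ))) * (2 + Real.pi) / |(-(2 * Real.pi * a))| * (1 / |(Real.pi * a) + (2 * Real.pi * a) * (-(1 / 2 : ℝ)) - Real.sqrt (-(khLam a β))| + 1 / |(Real.pi * a) + (2 * Real.pi * a) * (-(1 / 2 : ℝ)) + Real.sqrt (-(khLam a β))|) * (1 / (2 * |Real.sqrt (-(khLam a β))|)))) +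
      ((‖((starRingEnd ℂ (Complex.exp (2 * Real.pi * β * Complex.I))) * (-1 / ((1 - starRingEnd ℂ (Complex.exp (2 * Real.pi * β * Complex.I)) * (Real.exp (-(2 * Real.pi * a)) : ℂ)) * (2 * (2 * Real.pi * a)))) * Complex.exp (-((2 * Real.pi * a : ℝ) : ℂ) * (3 / 4 : ℝ)))‖ * Real.exp ((2 * Real.pi * a) * (1 / 4 : ℝ)) * (2 + Real.pi) / |(2 * Real.pi * a)| * (1 / |(0 : ℝ) + (-(2 * Real.pi * a)) * (1 / 4 : ℝ) - Real.sqrt (-(khLam a β))| + 1 / |(0 : ℝ) + (-(2 * Real.pi * a)) * (1 / 4 : ℝ) + Real.sqrt (-(khLam a β))|) * (1 / (2 * |Real.sqrt (-(khLam a β))|)) +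
        ‖((starRingEnd ℂ (Complex.exp (2 * Real.pi * β * Complex.I))) * (-1 / ((1 - starRingEnd ℂ (Complex.exp (2 * Real.pi * β * Complex.I)) * (Real.exp (-(2 * Real.pi * a)) : ℂ)) * (2 * (2 * Real.pi * a)))) * Complex.exp (-((2 * Real.pi * a : ℝ) : ℂ) * (3 / 4 : ℝ)))‖ * Real.exp ((2 * Real.pi * a) * (-(1 / 4 : ℝ))) * (2 + Real.pi) / |(2 * Real.pi * a)| * (1 / |(0 : ℝ) + (-(2 * Real.pi * a)) * (-(1 / 4 : ℝ)) - Real.sqrt (-(khLam a β))| + 1 / |(0 : ℝ) + (-(2 * Real.pi * a)) * (-(1 / 4 : ℝ)) + Real.sqrt (-(khLam a β))|) * (1 / (2 * |Real.sqrt (-(khLam a β))|))) +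
      (‖((starRingEnd ℂ (Complex.exp (2 * Real.pi * β * Complex.I))) * (-(Complex.exp (2 * Real.pi * β * Complex.I) * (Real.exp (-(2 * Real.pi * a)) : ℂ)) / ((1 - Complex.exp (2 * Real.pi * β * Complex.I) * (Real.exp (-(2 * Real.pi * a)) : ℂ)) * (2 * (2 * Real.pi * a)))) * Complex.exp (((2 * Real.pi * a : ℝ) : ℂ) * (3 / 4 : ℝ)))‖ * Real.exp ((-(2 * Real.pi * a)) * (1 / 4 : ℝ)) * (2 + Real.pi) / |(-(2 * Real.pi * a))| * (1 / |(0 : ℝ) + (-(2 * Real.pi * a)) * (1 / 4 : ℝ) - Real.sqrt (-(khLam a β))| + 1 / |(0 : ℝ) + (-(2 * Real.pi * a)) * (1 / 4 : ℝ) + Real.sqrt (-(khLam a β))|) * (1 / (2 * |Real.sqrt (-(khLam a β))|)) +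
        ‖((starRingEnd ℂ (Complex.exp (2 * Real.pi * β * Complex.I))) * (-(Complex.exp (2 * Real.pi * β * Complex.I) * (Real.exp (-(2 * Real.pi * a)) : ℂ)) / ((1 - Complex.exp (2 * Real.pi * β * Complex.I) * (Real.exp (-(2 * Real.pi * a)) : ℂ)) * (2 * (2 * Real.pi * a)))) * Complex.exp (((2 * Real.pi * a : ℝ) : ℂ) * (3 / 4 : ℝ)))‖ * Real.exp ((-(2 * Real.pi * a)) * (-(1 / 4 : ℝ))) * (2 + Real.pi) / |(-(2 * Real.pi * a))| * (1 / |(0 : ℝ) + (-(2 * Real.pi * a)) * (-(1 / 4 : ℝ)) - Real.sqrt (-(khLam a β))| + 1 / |(0 : ℝ) + (-(2 * Real.pi * a)) * (-(1 / 4 : ℝ)) + Real.sqrt (-(khLam a β))|) * (1 / (2 * |Real.sqrt (-(khLam a β))|)))) +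
      ((‖((starRingEnd ℂ (Complex.exp (2 * Real.pi * β * Complex.I))) * (-1 / ((1 - starRingEnd ℂ (Complex.exp (2 * Real.pi * β * Complex.I)) * (Real.exp (-(2 * Real.pi * a)) : ℂ)) * (2 * (2 * Real.pi * a)))) * Complex.exp (-((2 * Real.pi * a : ℝ) : ℂ) * (3 / 4 : ℝ)))‖ * Real.exp ((2 * Real.pi * a) * (1 / 2 : ℝ)) * (2 + Real.pi) / |(2 * Real.pi * a)| * (1 / |(-(Real.pi * a)) + (2 * Real.pi * a) * (1 / 2 : ℝ) - Real.sqrt (-(khLam a β))| + 1 / |(-(Real.pi * a)) + (2 * Real.pi * a) * (1 / 2 : ℝ) + Real.sqrt (-(khLam a β))|) * (1 / (2 * |Real.sqrt (-(khLam a β))|)) +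
        ‖((starRingEnd ℂ (Complex.exp (2 * Real.pi * β * Complex.I))) * (-1 / ((1 - starRingEnd ℂ (Complex.exp (2 * Real.pi * β * Complex.I)) * (Real.exp (-(2 * Real.pi * a)) : ℂ)) * (2 * (2 * Real.pi * a)))) * Complex.exp (-((2 * Real.pi * a : ℝ) : ℂ) * (3 / 4 : ℝ)))‖ * Real.exp ((2 * Real.pi * a) * (1 / 4 : ℝ)) * (2 + Real.pi) / |(2 * Real.pi * a)| * (1 / |(-(Real.pi * a)) + (2 * Real.pi * a) * (1 / 4 : ℝ) - Real.sqrt (-(khLam a β))| + 1 / |(-(Real.pi * a)) + (2 * Real.pi * a) * (1 / 4 : ℝ) + Real.sqrt (-(khLam a β))|) * (1 / (2 * |Real.sqrt (-(khLam a β))|))) +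
      (‖((starRingEnd ℂ (Complex.exp (2 * Real.pi * β * Complex.I))) * (-(Complex.exp (2 * Real.pi * β * Complex.I) * (Real.exp (-(2 * Real.pi * a)) : ℂ)) / ((1 - Complex.exp (2 * Real.pi * β * Complex.I) * (Real.exp (-(2 * Real.pi * a)) : ℂ)) * (2 * (2 * Real.pi * a)))) * Complex.exp (((2 * Real.pi * a : ℝ) : ℂ) * (3 / 4 : ℝ)))‖ * Real.exp ((-(2 * Real.pi * a)) * (1 / 2 : ℝ)) * (2 + Real.pi) / |(-(2 * Real.pi * a))| * (1 / |(-(Real.pi * a)) + (2 * Real.pi * a) * (1 / 2 : ℝ) - Real.sqrt (-(khLam a β))| + 1 / |(-(Real.pi * a)) + (2 * Real.pi * a) * (1 / 2 : ℝ) + Real.sqrt (-(khLam a β))|) * (1 / (2 * |Real.sqrt (-(khLam a β))|)) +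
        ‖((starRingEnd ℂ (Complex.exp (2 * Real.pi * β * Complex.I))) * (-(Complex.exp (2 * Real.pi * β * Complex.I) * (Real.exp (-(2 * Real.pi * a)) : ℂ)) / ((1 - Complex.exp (2 * Real.pi * β * Complex.I) * (Real.exp (-(2 * Real.pi * a)) : ℂ)) * (2 * (2 * Real.pi * a)))) * Complex.exp (((2 * Real.pi * a : ℝ) : ℂ) * (3 / 4 : ℝ)))‖ * Real.exp ((-(2 * Real.pi * a)) * (1 / 4 : ℝ)) * (2 + Real.pi) / |(-(2 * Real.pi * a))| * (1 / |(-(Real.pi * a)) + (2 * Real.pi * a) * (1 / 4 : ℝ) - Real.sqrt (-(khLam a β))| + 1 / |(-(Real.pi * a)) + (2 * Real.pi * a) * (1 / 4 : ℝ) + Real.sqrt (-(khLam a β))|) * (1 / (2 * |Real.sqrt (-(khLam a β))|))))) := by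
  have ha0 : 0 < a := by linarith
  obtain ⟨_, _, hω, hω1, hω2⟩ := sheetAmps_rate_window ha β
  rw [sheetAmps_singleMode_apply_1 ha]
  have hBc := norm_integral_cos_src_negQuarter_le ha0 β ξ hθ hω hω1 hω2 (K := kernelK a β) rfl (lineKernel_eq ha0 β)
  have hBs0 := norm_integral_sin_src_quarter_le ha0 β ξ hθ hω hω1 hω2 (K := kernelK a β) rfl (lineKernel_eq ha0 β)
  have hBs1 := norm_integral_sin_src_negQuarter_le ha0 β ξ hθ hω hω1 hω2 (K := kernelK a β) rfl (lineKernel_eq ha0 β)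
  exact norm_component_one_le (kc := fun s => Real.cos (Real.sqrt (-(khLam a β)) * (θ - s))) (ks := fun s => Real.sin (Real.sqrt (-(khLam a β)) * (θ - s)) / Real.sqrt (-(khLam a β)))
    (by fun_prop) (by fun_prop) (continuous_src ha0 β ξ (Or.inl rfl)) (continuous_src ha0 β ξ (Or.inr rfl)) (((2 * Real.pi * a : ℝ) * Complex.I : ℂ) * (-2)) (((2 * Real.pi * a : ℝ) * Complex.I : ℂ) * 2)
    (blockX a β 1 0) (blockX a β 1 1) hBc hBs0 hBs1


/-! ## Finite mode profiles: linearity, and the bound is uniform in the mode -/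

/-- The truncation window `[-K, K]` (p4). -/
def win (K : ℕ) : Finset ℤ := Finset.Icc (-(K : ℤ)) K

/-- The transverse profile `y ↦ Σ_{|n| ≤ K} c(n) e^{2πi(β+n)y}` of a truncated coefficient row (p4). -/
def modeProfile (β : ℝ) (K : ℕ) (c : ℤ → ℂ) : ℝ → ℂ :=
  fun y => ∑ n ∈ win K, c n * Complex.exp ((2 * Real.pi * (β + n) * y : ℝ) * Complex.I)

/-- The forcing is linear in the interior content: `forcing a β ⟨modeProfile β K c, []⟩ s = Σ_n c n • forcing a β (singleMode (β+n)) s` (`a > 0`). -/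
theorem forcing_modeProfile {a : ℝ} (ha : 0 < a) (β s : ℝ) (K : ℕ) (c : ℤ → ℂ) :
    forcing a β ⟨modeProfile β K c, []⟩ s = ∑ n ∈ win K, c n • forcing a β (singleMode (β + n)) s := by
  have h1 := integral_forcing_finset_sum ha β s (K := kernelK a β) rfl (lineKernel_eq ha β) (y₀ := 1 / 4) (Or.inl rfl) (win K) c
  have h2 := integral_forcing_finset_sum ha β s (K := kernelK a β) rfl (lineKernel_eq ha β) (y₀ := -(1 / 4)) (Or.inr rfl) (win K) c
  ext i
  rw [Finset.sum_apply]
  fin_cases i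
  · simp only [forcing, modeProfile, singleMode, transportPhase, List.map_nil, List.sum_nil, add_zero, Fin.zero_eta, Fin.isValue,
      Matrix.cons_val_zero, Pi.smul_apply, smul_eq_mul]
    rw [h1, Finset.mul_sum]
    exact Finset.sum_congr rfl fun n _ => by ring
  · simp only [forcing, modeProfile, singleMode, transportPhase, List.map_nil, List.sum_nil, add_zero, Fin.mk_one, Fin.isValue,
      Matrix.cons_val_one, Matrix.cons_val_zero, Pi.smul_apply, smul_eq_mul]
    rw [h2, Finset.mul_sum]
    exact Finset.sum_congr rfl fun n _ => by ring

/-- **Linearity of the created amplitudes:** `sheetAmps a β θ ⟨modeProfile β K c, []⟩ = Σ_n c n • sheetAmps a β θ (singleMode (β+n))` (`a ≥ 1`). -/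
theorem sheetAmps_modeProfile {a : ℝ} (ha : 1 ≤ a) (β θ : ℝ) (K : ℕ) (c : ℤ → ℂ) :
    sheetAmps a β θ ⟨modeProfile β K c, []⟩ = ∑ n ∈ win K, c n • sheetAmps a β θ (singleMode (β + n)) := by
  have ha0 : 0 < a := by linarith
  unfold sheetAmps
  simp_rw [forcing_modeProfile ha0, Matrix.mulVec_sum, Matrix.mulVec_smul]
  have hint : ∀ n ∈ win K, IntervalIntegrable (fun s => c n • (propagator a β (θ - s)).mulVec (forcing a β (singleMode (β + n)) s))
      volume 0 θ := fun n _ => ((continuous_duhamelIntegrand ha β (β + n) θ).intervalIntegrable (μ := volume) _ _).smul (c n)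
  rw [intervalIntegral.integral_finsetSum hint]
  refine Finset.sum_congr rfl fun n _ => ?_
  exact intervalIntegral.integral_smul _ _

/-- **The created amplitude of a finite mode profile is at most `(Σ_n ‖c n‖)` times the single-mode bound** — the single-mode bound being UNIFORM in the mode
(`ξ` enters only the Lorentzian's `ν₀`, which the envelope bounds ignore): component `0`. -/
theorem sheetAmps_modeProfile_norm_le_0 {a : ℝ} (ha : 1 ≤ a) (β : ℝ) {θ : ℝ} (hθ : 0 ≤ θ) (K : ℕ) (c : ℤ → ℂ) {B : ℝ}
    (hB : ∀ ξ : ℝ, ‖sheetAmps a β θ (singleMode ξ) 0‖ ≤ B) :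
    ‖sheetAmps a β θ ⟨modeProfile β K c, []⟩ 0‖ ≤ (∑ n ∈ win K, ‖c n‖) * B := by
  rw [sheetAmps_modeProfile ha, Finset.sum_apply, Finset.sum_mul]
  refine (norm_sum_le _ _).trans (Finset.sum_le_sum fun n _ => ?_)
  rw [Pi.smul_apply, norm_smul]
  have := hθ
  exact mul_le_mul_of_nonneg_left (hB (β + n)) (norm_nonneg _)

/-- Component `1`. -/
theorem sheetAmps_modeProfile_norm_le_1 {a : ℝ} (ha : 1 ≤ a) (β : ℝ) {θ : ℝ} (hθ : 0 ≤ θ) (K : ℕ) (c : ℤ → ℂ) {B : ℝ}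
    (hB : ∀ ξ : ℝ, ‖sheetAmps a β θ (singleMode ξ) 1‖ ≤ B) :
    ‖sheetAmps a β θ ⟨modeProfile β K c, []⟩ 1‖ ≤ (∑ n ∈ win K, ‖c n‖) * B := by
  rw [sheetAmps_modeProfile ha, Finset.sum_apply, Finset.sum_mul]
  refine (norm_sum_le _ _).trans (Finset.sum_le_sum fun n _ => ?_)
  rw [Pi.smul_apply, norm_smul]
  have := hθ
  exact mul_le_mul_of_nonneg_left (hB (β + n)) (norm_nonneg _)


/-! ## The block entries of the crux copy: kernel values by name, sizes -/

/-- `2π · lineKernel a β 0 = Σ₀(a,β)` (tree `twoPi_lineKernel_zero`). -/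
theorem twoPi_lineKernel_zero' {a : ℝ} (ha : 0 < a) (β : ℝ) :
    (2 * Real.pi : ℂ) * lineKernel a β 0 = ((sawSigma0 a β : ℝ) : ℂ) := by
  have h := twoPi_lineKernel_zero ha β
  have hz : Complex.exp (2 * Real.pi * β * Complex.I) = Complex.exp (((2 * Real.pi * β : ℝ) : ℂ) * Complex.I) := by push_cast; ring_nf
  simp only [lineKernel, Int.floor_zero, Int.cast_zero, Complex.ofReal_zero, sub_zero, mul_zero, zero_mul, neg_zero, Real.exp_zero,
    Complex.ofReal_one, Complex.exp_zero, one_mul, zero_sub, mul_neg, mul_one, abs_of_pos ha, hz]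
  convert h using 3
  push_cast
  ring

/-- `2π · conj (lineKernel a β ½) = S_β(a)` (tree `twoPi_conj_lineKernel_half`). -/
theorem twoPi_conj_lineKernel_half' {a : ℝ} (ha : 0 < a) (β : ℝ) :
    (2 * Real.pi : ℂ) * starRingEnd ℂ (lineKernel a β (1 / 2)) = sawS a β := by
  have h := twoPi_conj_lineKernel_half ha β
  have hz : Complex.exp (2 * Real.pi * β * Complex.I) = Complex.exp (((2 * Real.pi * β : ℝ) : ℂ) * Complex.I) := by push_cast; ring_nf
  have hfl : ⌊(1 / 2 : ℝ)⌋ = 0 := by norm_num [Int.floor_eq_zero_iff]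
  have he1 : Real.exp (-(2 * Real.pi * a * (1 / 2))) = Real.exp (-(a * Real.pi)) := by congr 1; ring
  have he2 : Real.exp (2 * Real.pi * a * (1 / 2 - 1)) = Real.exp (-(a * Real.pi)) := by congr 1; ring
  simp only [lineKernel, hfl, Int.cast_zero, Complex.ofReal_zero, sub_zero, mul_zero, zero_mul, Complex.exp_zero, one_mul,
    abs_of_pos ha, hz, he1, he2]
  convert h using 3
  push_cast
  ring

/-- The four block entries (`a ≥ 1`): `‖X₀₀‖, ‖X₁₁‖ ≤ πa/2` and `‖X₀₁‖, ‖X₁₀‖ ≤ 40/399`. -/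
theorem norm_blockX_entries_le {a : ℝ} (ha : 1 ≤ a) (β : ℝ) :
    ‖blockX a β 0 0‖ ≤ Real.pi * a / 2 ∧ ‖blockX a β 1 1‖ ≤ Real.pi * a / 2 ∧ ‖blockX a β 0 1‖ ≤ 40 / 399 ∧ ‖blockX a β 1 0‖ ≤ 40 / 399 := by
  have ha0 : 0 < a := by linarith
  have h0 := twoPi_lineKernel_zero' ha0 β
  have hh := twoPi_conj_lineKernel_half' ha0 β
  have hq0 : 0 < sawQ a := sawQ_pos a
  have hq1 : sawQ a < 1 := sawQ_lt_one ha0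
  have hpos : 0 ≤ (1 - sawQ a) / (1 + sawQ a) := by apply div_nonneg <;> linarith
  have hd := norm_blockX_diag_le ha h0
  have ho := norm_blockX_off_le ha hh
  have e00 : blockX a β 0 0 = (((2 * Real.pi * a : ℝ) : ℂ) * Complex.I) * (-(1 / 4 : ℂ) - 2 * lineKernel a β 0) := by
    simp [blockX, Matrix.smul_apply, smul_eq_mul]
  have e01 : blockX a β 0 1 = (((2 * Real.pi * a : ℝ) : ℂ) * Complex.I) * (-2 * lineKernel a β (1 / 2)) := by
    simp [blockX, Matrix.smul_apply, smul_eq_mul]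
  have e11 : ‖blockX a β 1 1‖ = ‖(((2 * Real.pi * a : ℝ) : ℂ) * Complex.I) * (-(1 / 4 : ℂ) - 2 * lineKernel a β 0)‖ := by
    have : blockX a β 1 1 = -((((2 * Real.pi * a : ℝ) : ℂ) * Complex.I) * (-(1 / 4 : ℂ) - 2 * lineKernel a β 0)) := by
      simp [blockX, Matrix.smul_apply, smul_eq_mul]; ring
    rw [this, norm_neg]
  have e10 : ‖blockX a β 1 0‖ = ‖(((2 * Real.pi * a : ℝ) : ℂ) * Complex.I) * (-2 * lineKernel a β (1 / 2))‖ := by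
    have : blockX a β 1 0 = (((2 * Real.pi * a : ℝ) : ℂ) * Complex.I) * (2 * starRingEnd ℂ (lineKernel a β (1 / 2))) := by
      simp [blockX, Matrix.smul_apply, smul_eq_mul]
    rw [this]; simp only [norm_mul, Complex.norm_conj, norm_neg]
  refine ⟨?_, ?_, ?_, ?_⟩
  · rw [e00]; linarith
  · rw [e11]; linarith
  · rw [e01]; exact ho
  · rw [e10]; exact ho

/-! ## The numbers: `‖sheetAmps‖ ≤ 8.5/a` -/

/-- The couplings: `‖2πia·(−2)‖ = ‖2πia·2‖ = 4πa`. -/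
theorem norm_coupling {a : ℝ} (ha : 0 < a) :
    ‖(((2 * Real.pi * a : ℝ) * Complex.I : ℂ) * (-2))‖ = 4 * Real.pi * a ∧ ‖(((2 * Real.pi * a : ℝ) * Complex.I : ℂ) * 2)‖ = 4 * Real.pi * a := by
  have hκ : 0 < 2 * Real.pi * a := by positivity
  refine ⟨?_, ?_⟩
  · rw [norm_mul, norm_mul, Complex.norm_real, Complex.norm_I, Real.norm_eq_abs, abs_of_pos hκ, norm_neg]
    simp; ring
  · rw [norm_mul, norm_mul, Complex.norm_real, Complex.norm_I, Real.norm_eq_abs, abs_of_pos hκ]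
    simp; ring

/-- The final arithmetic: `4πa·(0.163/a²) + (πa/2)·4πa·(0.3/a³) + (40/399)·4πa·(0.3/a³) ≤ 8.5/a` for `a ≥ 1`. -/
theorem creation_arith {a : ℝ} (ha : 1 ≤ a) :
    4 * Real.pi * a * (0.163 / a ^ 2) + Real.pi * a / 2 * (4 * Real.pi * a) * (0.3 / a ^ 3) + 40 / 399 * (4 * Real.pi * a) * (0.3 / a ^ 3) ≤
      8.5 / a := by
  have ha0 : 0 < a := by linarith
  have hπ : Real.pi < 3.1416 := Real.pi_lt_d4
  have hπ0 : 0 < Real.pi := Real.pi_pos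
  have e : 4 * Real.pi * a * (0.163 / a ^ 2) + Real.pi * a / 2 * (4 * Real.pi * a) * (0.3 / a ^ 3) + 40 / 399 * (4 * Real.pi * a) * (0.3 / a ^ 3) =
      (0.652 * Real.pi + 0.6 * Real.pi ^ 2 + (48 * Real.pi / 399) / a) / a := by
    field_simp; ring
  rw [e]
  apply div_le_div_of_nonneg_right _ ha0.le
  have h3 : (48 * Real.pi / 399) / a ≤ 48 * Real.pi / 399 := div_le_self (by positivity) ha
  nlinarith [mul_pos hπ0 hπ0]

/-- **Single-mode stable-block creation law, amplitude level, WITH A NUMBER, component `0`:** for `a ≥ 1`, `θ ≥ 0`, every Bloch phase `β`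
and every mode `ξ`, `‖sheetAmps a β θ (singleMode ξ) 0‖ ≤ 8.5/a`. -/
theorem sheetAmps_singleMode_norm_le_num_0 {a : ℝ} (ha : 1 ≤ a) (β ξ : ℝ) {θ : ℝ} (hθ : 0 ≤ θ) :
    ‖sheetAmps a β θ (singleMode ξ) 0‖ ≤ 8.5 / a := by
  have ha0 : 0 < a := by linarith
  obtain ⟨hlo, hhi, _, _, _⟩ := sheetAmps_rate_window ha β
  obtain ⟨hx00, _, hx01, _⟩ := norm_blockX_entries_le ha β
  obtain ⟨hc0, hc1⟩ := norm_coupling ha0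
  have Bc0 := twelveTerm_cos_quarter_le ha β hlo hhi
  have Bs0 := twelveTerm_sin_quarter_le ha β hlo hhi
  have Bs1 := twelveTerm_sin_negQuarter_le ha β hlo hhi
  have h0 := sheetAmps_singleMode_norm_le_0 ha β ξ hθ
  rw [hc0, hc1] at h0
  have hA := creation_arith ha
  have hκ4 : (0 : ℝ) ≤ 4 * Real.pi * a := by positivity
  have p1 := mul_le_mul_of_nonneg_left Bc0 hκ4
  have p2 := mul_le_mul (mul_le_mul_of_nonneg_right hx00 hκ4) Bs0 (by positivity) (by positivity)
  have p3 := mul_le_mul (mul_le_mul_of_nonneg_right hx01 hκ4) Bs1 (by positivity) (by positivity)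
  linarith

/-- Component `1`: `‖sheetAmps a β θ (singleMode ξ) 1‖ ≤ 8.5/a` (`a ≥ 1`, `θ ≥ 0`). -/
theorem sheetAmps_singleMode_norm_le_num_1 {a : ℝ} (ha : 1 ≤ a) (β ξ : ℝ) {θ : ℝ} (hθ : 0 ≤ θ) :
    ‖sheetAmps a β θ (singleMode ξ) 1‖ ≤ 8.5 / a := by
  have ha0 : 0 < a := by linarith
  obtain ⟨hlo, hhi, _, _, _⟩ := sheetAmps_rate_window ha β
  obtain ⟨_, hx11, _, hx10⟩ := norm_blockX_entries_le ha β
  obtain ⟨hc0, hc1⟩ := norm_coupling ha0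
  have Bc1 := twelveTerm_cos_negQuarter_le ha β hlo hhi
  have Bs0 := twelveTerm_sin_quarter_le ha β hlo hhi
  have Bs1 := twelveTerm_sin_negQuarter_le ha β hlo hhi
  have h1 := sheetAmps_singleMode_norm_le_1 ha β ξ hθ
  rw [hc0, hc1] at h1
  have hA := creation_arith ha
  have hκ4 : (0 : ℝ) ≤ 4 * Real.pi * a := by positivity
  have p1 := mul_le_mul_of_nonneg_left Bc1 hκ4
  have p2 := mul_le_mul (mul_le_mul_of_nonneg_right hx10 hκ4) Bs0 (by positivity) (by positivity)
  have p3 := mul_le_mul (mul_le_mul_of_nonneg_right hx11 hκ4) Bs1 (by positivity) (by positivity)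
  linarith

/-- **Finite mode profiles, with a number:** `‖sheetAmps a β θ ⟨modeProfile β K c, []⟩ i‖ ≤ (Σ_{n ∈ win K} ‖c n‖) · 8.5/a` (`a ≥ 1`, `θ ≥ 0`). -/
theorem sheetAmps_modeProfile_norm_le_num {a : ℝ} (ha : 1 ≤ a) (β : ℝ) {θ : ℝ} (hθ : 0 ≤ θ) (K : ℕ) (c : ℤ → ℂ) :
    ‖sheetAmps a β θ ⟨modeProfile β K c, []⟩ 0‖ ≤ (∑ n ∈ win K, ‖c n‖) * (8.5 / a) ∧
      ‖sheetAmps a β θ ⟨modeProfile β K c, []⟩ 1‖ ≤ (∑ n ∈ win K, ‖c n‖) * (8.5 / a) :=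
  ⟨sheetAmps_modeProfile_norm_le_0 ha β hθ K c fun ξ => sheetAmps_singleMode_norm_le_num_0 ha β ξ hθ,
    sheetAmps_modeProfile_norm_le_1 ha β hθ K c fun ξ => sheetAmps_singleMode_norm_le_num_1 ha β ξ hθ⟩


/-! ## Energy: the single-mode creation law as an ENERGY RATIO (`E_created ≤ 2810/a · E_source`, i.e. `C_rig = 53`) -/

/-- A bare sheet pair on the kink lines with amplitudes `(q₊, q₋)` and no interior content (p4). -/
def sheetPair (qp qm : ℂ) : LamState := ⟨fun _ => 0, [((1 / 4 : ℝ), qp), (-(1 / 4 : ℝ), qm)]⟩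

/-- Transverse Fourier coefficient at `β + n` (p4). -/
def coeff (β : ℝ) (st : LamState) (n : ℤ) : ℂ :=
  (∫ y in (-(1 / 2 : ℝ))..(1 / 2), st.interior y * Complex.exp (-(2 * Real.pi * (β + n) * y : ℝ) * Complex.I))
    + (st.sheets.map (fun p => p.2 * Complex.exp (-(2 * Real.pi * (β + n) * p.1 : ℝ) * Complex.I))).sum

/-- Kinetic energy of the state on the family `(a, β)` (p4). -/
def energy (a β : ℝ) (st : LamState) : ℝ :=
  ∑' n : ℤ, ‖coeff β st n‖ ^ 2 / (4 * Real.pi ^ 2 * (a ^ 2 + (β + n) ^ 2))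

/-- Orthogonality on one period: `∫_{−½}^{½} e^{2πiky} dy = 0` for a nonzero integer `k`, `= 1` for `k = 0` — in the form met by `coeff (singleMode (β+n₀)) n`. -/
theorem integral_cexp_int_mul {k : ℤ} :
    ∫ y in (-(1 / 2 : ℝ))..(1 / 2), Complex.exp (((2 * Real.pi * k * y : ℝ) : ℂ) * Complex.I) = if k = 0 then 1 else 0 := by
  split_ifs with hk
  · subst hk; simp; norm_num
  · have hc : (((2 * Real.pi * k : ℝ) : ℂ) * Complex.I) ≠ 0 := by
      apply mul_ne_zero _ Complex.I_ne_zero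
      exact_mod_cast (mul_ne_zero (mul_ne_zero two_ne_zero Real.pi_ne_zero) (Int.cast_ne_zero.2 hk))
    have e : ∀ y : ℝ, Complex.exp (((2 * Real.pi * k * y : ℝ) : ℂ) * Complex.I) = Complex.exp ((((2 * Real.pi * k : ℝ) : ℂ) * Complex.I) * y) := by
      intro y; congr 1; push_cast; ring
    simp_rw [e]
    rw [integral_exp_mul_complex hc]
    have h1 : Complex.exp ((((2 * Real.pi * k : ℝ) : ℂ) * Complex.I) * (1 / 2 : ℝ)) = Complex.exp ((Real.pi * k : ℝ) * Complex.I) := by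
      congr 1; push_cast; ring
    have h2 : Complex.exp ((((2 * Real.pi * k : ℝ) : ℂ) * Complex.I) * (-(1 / 2) : ℝ)) = Complex.exp (-((Real.pi * k : ℝ) * Complex.I)) := by
      congr 1; push_cast; ring
    rw [h1, h2]
    -- `e^{iπk} = e^{−iπk}` for integer `k` (both `= (−1)^k`): their difference vanishes
    have h3 : Complex.exp ((Real.pi * k : ℝ) * Complex.I) = Complex.exp (-((Real.pi * k : ℝ) * Complex.I)) := by
      rw [← mul_inv_eq_one₀ (Complex.exp_ne_zero _), ← Complex.exp_neg, ← Complex.exp_add, neg_neg,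
        show (Real.pi * k : ℝ) * Complex.I + (Real.pi * k : ℝ) * Complex.I = (k : ℂ) * (2 * Real.pi * Complex.I) by push_cast; ring]
      exact Complex.exp_int_mul_two_pi_mul_I k
    rw [h3, sub_self, zero_div]

/-- The coefficients of the single lattice mode `ξ = β + n₀`: `ζ̂(n) = δ_{n,n₀}`. -/
theorem coeff_singleMode (β : ℝ) (n₀ n : ℤ) : coeff β (singleMode (β + n₀)) n = if n = n₀ then 1 else 0 := by
  simp only [coeff, singleMode, List.map_nil, List.sum_nil, add_zero]
  have e : ∀ y : ℝ, Complex.exp (((2 * Real.pi * (β + n₀) * y : ℝ) : ℂ) * Complex.I) * Complex.exp (-((2 * Real.pi * (β + n) * y : ℝ) : ℂ) * Complex.I) =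
      Complex.exp (((2 * Real.pi * ((n₀ - n : ℤ)) * y : ℝ) : ℂ) * Complex.I) := by
    intro y; rw [← Complex.exp_add]; congr 1; push_cast; ring
  simp_rw [e, integral_cexp_int_mul]
  by_cases h : n = n₀
  · subst h; simp
  · rw [if_neg (sub_ne_zero.2 (Ne.symm h)), if_neg h]

/-- **Energy of the single lattice mode:** `energy a β (singleMode (β+n₀)) = 1/(4π²(a² + (β+n₀)²))`. -/
theorem energy_singleMode (a β : ℝ) (n₀ : ℤ) : energy a β (singleMode (β + n₀)) = 1 / (4 * Real.pi ^ 2 * (a ^ 2 + (β + n₀) ^ 2)) := by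
  unfold energy
  simp_rw [coeff_singleMode]
  rw [tsum_eq_single n₀ (fun n hn => by simp [hn])]
  simp

/-- **Energy of the created pair:** `energy a β (sheetPair q₀ q₁) ≤ (0.56/a)(‖q₀‖² + ‖q₁‖²)/(2π)` for `a ≥ 1` (tree `sheetPair_energy_le` +
`gram_upper_le_of_one_le`). -/
theorem energy_sheetPair_le {a : ℝ} (ha : 1 ≤ a) (β : ℝ) (qp qm : ℂ) :
    energy a β (sheetPair qp qm) ≤ 0.56 / a * (‖qp‖ ^ 2 + ‖qm‖ ^ 2) / (2 * Real.pi) := by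
  have ha0 : 0 < a := by linarith
  unfold energy
  have hc : ∀ n : ℤ, coeff β (sheetPair qp qm) n = qp * Complex.exp (-(2 * Real.pi * (β + n) * (1 / 4 : ℝ) : ℝ) * Complex.I) +
      qm * Complex.exp (-(2 * Real.pi * (β + n) * (-(1 / 4 : ℝ)) : ℝ) * Complex.I) := fun n => by simp [coeff, sheetPair]
  simp_rw [hc]
  refine (sheetPair_energy_le ha0 β qp qm).trans ?_
  have hg := gram_upper_le_of_one_le ha (-β)
  have hn : Complex.normSq qp + Complex.normSq qm = ‖qp‖ ^ 2 + ‖qm‖ ^ 2 := by rw [Complex.normSq_eq_norm_sq, Complex.normSq_eq_norm_sq]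
  rw [hn]
  exact div_le_div_of_nonneg_right (mul_le_mul_of_nonneg_right hg (by positivity)) (by positivity)

/-- **The single-mode stable-block creation law as an ENERGY RATIO** (p4's `StableBlockCreation` shape, one cascade-type lattice mode, `a ≥ 1`):
the energy of the sheet pair created over a slot of any length `θ ≥ 0` from the unit interior mode `ξ = β + n₀` with `|ξ| ≤ a/8 + 2` is at most
`2900/a` times the mode's energy — `C_rig = 54` against p4's measured `3.1` (`a = 1`) / `2.2`. -/
theorem energy_created_singleMode_le {a : ℝ} (ha : 1 ≤ a) (β : ℝ) (n₀ : ℤ) (hξ : |β + n₀| ≤ a / 8 + 2) {θ : ℝ} (hθ : 0 ≤ θ) :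
    energy a β (sheetPair (sheetAmps a β θ (singleMode (β + n₀)) 0) (sheetAmps a β θ (singleMode (β + n₀)) 1)) ≤
      2900 / a * energy a β (singleMode (β + n₀)) := by
  have ha0 : 0 < a := by linarith
  have h0 := sheetAmps_singleMode_norm_le_num_0 ha β (β + n₀) hθ
  have h1 := sheetAmps_singleMode_norm_le_num_1 ha β (β + n₀) hθ
  refine (energy_sheetPair_le ha β _ _).trans ?_
  rw [energy_singleMode]
  have hq0 : ‖sheetAmps a β θ (singleMode (β + n₀)) 0‖ ^ 2 ≤ (8.5 / a) ^ 2 := pow_le_pow_left₀ (norm_nonneg _) h0 2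
  have hq1 : ‖sheetAmps a β θ (singleMode (β + n₀)) 1‖ ^ 2 ≤ (8.5 / a) ^ 2 := pow_le_pow_left₀ (norm_nonneg _) h1 2
  have hπ : Real.pi < 3.1416 := Real.pi_lt_d4
  have hπ0 : 0 < Real.pi := Real.pi_pos
  -- `(a² + ξ²) ≤ a²(1 + (1/8 + 2)²)` for `a ≥ 1`
  have hξ2 : (β + n₀) ^ 2 ≤ (a / 8 + 2) ^ 2 := by
    have := abs_nonneg (β + n₀)
    calc (β + n₀) ^ 2 = |β + n₀| ^ 2 := (sq_abs _).symm
      _ ≤ (a / 8 + 2) ^ 2 := pow_le_pow_left₀ this hξ 2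
  have hsum : ‖sheetAmps a β θ (singleMode (β + n₀)) 0‖ ^ 2 + ‖sheetAmps a β θ (singleMode (β + n₀)) 1‖ ^ 2 ≤ 2 * (8.5 / a) ^ 2 := by
    linarith
  calc 0.56 / a * (‖sheetAmps a β θ (singleMode (β + n₀)) 0‖ ^ 2 + ‖sheetAmps a β θ (singleMode (β + n₀)) 1‖ ^ 2) / (2 * Real.pi)
      ≤ 0.56 / a * (2 * (8.5 / a) ^ 2) / (2 * Real.pi) := by gcongr
    _ ≤ 2900 / a * (1 / (4 * Real.pi ^ 2 * (a ^ 2 + (β + n₀) ^ 2))) := by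
        rw [show 0.56 / a * (2 * (8.5 / a) ^ 2) / (2 * Real.pi) = 80.92 / (a ^ 3 * (2 * Real.pi)) by field_simp; ring,
          show 2900 / a * (1 / (4 * Real.pi ^ 2 * (a ^ 2 + (β + n₀) ^ 2))) = 2900 / (a * (4 * Real.pi ^ 2 * (a ^ 2 + (β + n₀) ^ 2))) by
            field_simp]
        rw [div_le_div_iff₀ (by positivity) (by positivity)]
        -- `80.92 · a · 4π²(a² + ξ²) ≤ 80.92·4·9.87·5.52·a³ = 17635 a³ ≤ 18220 a³ ≤ 2900 · a³ · 2π`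
        have h5 : a ^ 2 + (β + n₀) ^ 2 ≤ 5.52 * a ^ 2 := by nlinarith
        have k1 : Real.pi ^ 2 ≤ 9.87 := by nlinarith
        have k2 : 4 * Real.pi ^ 2 * (a ^ 2 + (β + n₀) ^ 2) ≤ 4 * 9.87 * (5.52 * a ^ 2) :=
          mul_le_mul (by linarith) h5 (by positivity) (by positivity)
        have k3 : 80.92 * (a * (4 * Real.pi ^ 2 * (a ^ 2 + (β + n₀) ^ 2))) ≤ 80.92 * (a * (4 * 9.87 * (5.52 * a ^ 2))) :=
          mul_le_mul_of_nonneg_left (mul_le_mul_of_nonneg_left k2 ha0.le) (by norm_num)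
        have k4 : (3.1415 : ℝ) < Real.pi := Real.pi_gt_d4
        have ha3 : 0 < a ^ 3 := by positivity
        have k5 : 80.92 * (a * (4 * 9.87 * (5.52 * a ^ 2))) ≤ 2900 * (a ^ 3 * (2 * Real.pi)) := by nlinarith
        linarith

end

end Summit.AnomalousDissipation.AnomalousDissipation.Cruxes.K1LocalisedCascade.K2StableCreation
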